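import Summits.AtomisticToContinuum.HydrodynamicLimit.Theses.AntiMazurCoboundaries
import Summits.AtomisticToContinuum.HydrodynamicLimit.Theses.FluxGibbsianityLdDrude
import Summits.AtomisticToContinuum.HydrodynamicLimit.Theses.TwoClocks
import Literature.MathematicalPhysics.KineticTheory.HardSphereEulerLLN
import Summits.AtomisticToContinuum.HydrodynamicLimit.Theorems.KineticWindowGronwall.Negative.CubicMomentDiverges
import Summits.AtomisticToContinuum.HydrodynamicLimit.Theorems.KineticWindowGronwall.Negative.ConsequentLoadBearing
import Summits.AtomisticToContinuum.HydrodynamicLimit.Theorems.OneFlightGossipEngineClampedCurrentsDockKineticInstance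
import Summits.AtomisticToContinuum.HydrodynamicLimit.Theorems.ImplosionDichotomyHydroLimitInBandOfHeart
import Summits.AtomisticToContinuum.HydrodynamicLimit.Theorems.AntiMazurCoboundariesKineticWindowGronwallLadderAssembly
import Summits.AtomisticToContinuum.HydrodynamicLimit.Theorems.AntiMazurCoboundariesKineticWindowGronwallClockFromInstance
import Summits.AtomisticToContinuum.HydrodynamicLimit.Theorems.AntiMazurCoboundariesKineticWindowGronwallReorthCut
import Summits.AtomisticToContinuum.HydrodynamicLimit.Theorems.AntiMazurCoboundariesKineticWindowGronwallProductKineticInstance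
import Summits.AtomisticToContinuum.HydrodynamicLimit.Theorems.AntiMazurCoboundariesKineticWindowGronwallRareBandDock
import Summits.AtomisticToContinuum.HydrodynamicLimit.Theorems.AntiMazurCoboundariesKineticWindowGronwallTwoProfileTransfer
import Summits.AtomisticToContinuum.HydrodynamicLimit.Theorems.AntiMazurCoboundariesKineticWindowGronwallWindowEnergyMoment
import Summits.AtomisticToContinuum.HydrodynamicLimit.Theorems.AntiMazurCoboundariesKineticWindowGronwallTailReorth
import Summits.AtomisticToContinuum.HydrodynamicLimit.Theorems.AntiMazurCoboundariesKineticWindowGronwallFamilyGlue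
import Summits.AtomisticToContinuum.HydrodynamicLimit.Theorems.AntiMazurCoboundariesKineticWindowGronwallPlusNode

/-!
# Crux `KineticWindowGronwall` (stmt-AtomisticToContinuum-9282) — skeleton line `rare-band-ladder-dock`

v7.1 (lead c5, cycle 1, wave 1 integrated): `stub_windowEnergyMoment` (p146839), `stub_tailReorth` (p147043) LANDED by workers and
`stub_familyGlue` PROVED (`Theorems.KineticWindowGronwallFamilyGlue.familyGlue_of`, p148139; helper files …FamilyGlueCompare p147635,
…FamilyGluePrelim p148049) modulo the one helper still with its worker, `stub_twoProfileTransfer`; the wall re-typed in TwoClocks'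
vocabulary (`Theorems.KineticWindowGronwallPlusNode`, p148050/p148314: `KineticWindowLDBoundsUniform`, `LocalGibbsTransferPlus ⟹ 14443 ∧ LocalTransferEB`).
`stub_twoProfileTransfer` LANDED too (p148641). Remaining sorries (3) = the INPUTS: `stub_equilibriumFastWindowLD` (14440), `stub_localTransferQB` (wall), `stub_sharedInputs`.

v7 (lead c5, 2026-08-17, cycle 1): RESHAPE OF THE PROMOTED WALL. Lead c4's dock audit lists the residual content of
`stub_localTransfer` as (i) one-window pressure-level locality, (ii) density-band uniformity, (iii) s-uniformity + window upgrade
under the NON-invariant local reference. Half of (iii) is NOT content and is discharged here by proof: GIVEN an amplitude uniform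
over bounded profile classes (which every cell/corridor proof of TwoClocks 14443 yields — cf. the 14443 birth line's
`FrozenEquilibriumCore`: ONE `β₀(θ-range, u-range, band, C)`), thresholds POINTWISE in the profile upgrade to thresholds UNIFORM
along any jointly continuous family: finite net in `s` + a STATIC order-2 Rényi change of measure between local Gibbs laws with
nearby profiles (two-profile form of the landed `KineticCurrentsWindowLDUniformSigmaUniform.stub_staticFreezing` statics) + energy
conservation for the small quadratic remainders + the node itself applied to ONE re-orthogonalised thermal-frame tail observable per
net point (a general continuous `g` of quadratic growth is uniformly continuous only on bulk balls; its far tail is an LD input, not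
a static one, under a non-invariant reference). New statements (§1c): the profile-wise, family-free wall node
`LocalQuadraticWindowLDBounds` (amplitude `c⋆(θm, θM, U, σ)` before the profiles; `τ₀, N₀` after; all windows), the wall
`LocalTransferQB := QuadraticClassLdDecay → LocalQuadraticWindowLDBounds` (registered, OPEN, shared with 14443 / 16625-S3b — same
exposure as v6's `LocalTransferQ`, now typed without families), its dockable twin `LocalTransferEB` (antecedent 14440), the glue
`FamilyGlue := LocalQuadraticWindowLDBounds → LocalQuadraticWindowLDFamily` (registered, PROVABLE, lead) and three analytic helper
stubs for the worker wave: `TwoProfileTransfer` (static change of measure), `WindowEnergyMoment` (window exponential moment of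
`λΣ(1+‖vᵢ‖²)` by energy conservation + fibre Gaussians), `TailReorth` (the re-orthogonalised radial tail cut-off, pure Gaussian
analysis). `stub_localTransfer : LocalTransferQ` is now DERIVED (`familyGlue ∘ localTransferQB`); the composition
`KineticWindowGronwall_of` is unchanged (A consumed by the ladder). Registered sorries (7): `stub_equilibriumFastWindowLD` (14440),
`stub_sharedInputs` (board inputs), `stub_localTransferQB` (wall), `stub_familyGlue`, `stub_twoProfileTransfer`,
`stub_windowEnergyMoment`, `stub_tailReorth`.

v6 (lead c4, 2026-08-17, cycle 1): THE RARE BAND DOCKED ON THE BOARD. `stub_rareBand : RareBandLdDecay` is now PROVED below from the new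
by-name input stub `stub_equilibriumFastWindowLD : TwoClocks.EquilibriumFastWindowLD` (board crux stmt-14440) through the LANDED dock
`Theorems/AntiMazurCoboundariesKineticWindowGronwallRareBandDock.lean` (`rareBandLdDecay_of_equilibriumFastWindowLD`: Baire uniform tilt range
of 14440 without compact support — `…RareBandDockUniformRange.lean`, p141535 — + flow independence of window moments + Gaussian frame change; helper
stubs `stub_uniformWindowLD`, `stub_rareBandDock`). REMAINING SORRIES = three inputs BY NAME: `stub_equilibriumFastWindowLD` (14440),
`stub_localTransfer` (crux-sized shared kinetic wall = TwoClocks 14443 / 16625-S3b in product form; wave-1 dock audit: not dockable by logic),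
`stub_sharedInputs` (LCTF, CSCV-W, 16624, 9235, 3091; wave-1 dock audit: all five open). New compositions `KineticWindowGronwall_of_board`
(`EquilibriumFastWindowLD → LocalTransferQ → SharedInputs → crux`) and honesty lemma `antecedent_of_equilibriumFastWindowLD` (given 14440 the
crux's antecedent A is formally idle: `A ⇐ 14440`; A is load-bearing only relative to the strictly weaker pair `(A, RareBandLdDecay)`, §4).
The board end state is also landed as a Theorems file: `Theorems/AntiMazurCoboundariesKineticWindowGronwallEndStateBoard.lean` (p144558, resubmit of p143776; registered helper
stub `stub_cruxOfBoardInputs : CruxOfBoardInputs := EquilibriumFastWindowLD → LocalTransferE → SharedInputs → KineticWindowGronwall`; same terms as §1a/§3 here).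

v5 (lead c3, 2026-08-17, end of cycle 1): ALL FOUR PROVABLE STUBS LANDED and discharged below by import (same terms) — 2a `stub_reorthCut`
(p140004, prelim p139550), 2b `stub_ladderAssembly` (p139292, helper p139021), 4a `stub_productKineticInstance` (p140192, prelims p139986,
p139766), 4b `stub_clockFromInstance` (p139122); honesty lemmas `rareBand_of_quadraticClass`, `quadraticClass_iff_of_cut` (§4). REMAINING
SORRIES = exactly the three OPEN inputs: `stub_rareBand` (the line's new open equilibrium LD lemma), `stub_localTransfer` (crux-sized shared
kinetic wall, = TwoClocks 14443 / 16625-S3b content), `stub_sharedInputs` (five board items by name). End state landed separately as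
`Theorems/AntiMazurCoboundariesKineticWindowGronwallEndState.lean` (`kineticWindowGronwall_of_open : RareBandLdDecay → LocalTransferQ →
SharedInputs → KineticWindowGronwall`).

v2 (lead c3, prover-line-stmt-AtomisticToContinuum-9282-c3-0, 2026-08-17): RESHAPE of the strategist's v1 to seven registered
stubs, composition unchanged in idea. `stub_amplitudeLadder` ↦ `stub_reorthCut` (the static Gaussian re-orthogonalising cut,
`ReorthogonalisingCut`) + `stub_ladderAssembly` (`ReorthogonalisingCut → AmplitudeLadder`: window upgrade `∃τ ⇒ ∀τ ≥ τ₀` by the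
landed subadditivity + static Gaussian bound, common window, Cauchy–Schwarz); `stub_entropyClockRE` ↦ `stub_productKineticInstance`
(`LocalQuadraticWindowLDFamily → KineticInstanceOut`, the product node gives VERBATIM the conclusion of the landed kinetic instance
KC1 `ClampedCurrentsDockKineticInstance.KineticInstance`, by a thermal-frame product decomposition of its class member and Hölder over
the rank) + `stub_clockFromInstance` (`KineticInstanceOut → … → RelEntropyVanishing`: the landed window clause `stub_windowClause` re-run
with KC1's OUTPUT in place of KCWU-along-families, the landed static clause, ledger, Grönwall core in band, and the landed
`relEntropyDock_of_core` pattern unguarded by `DiluteSelfConsistency`). `stub_rareBand`, `stub_localTransfer`, `stub_sharedInputs`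
unchanged. `KineticWindowGronwall_of` is the seven-stub composition (sorry-free, crux BY NAME, A consumed in `stub_ladderAssembly`).

Crux (FIXED, route AntiMazurCoboundaries, shared verbatim with FluxGibbsianityLdDrude):
`KineticWindowGronwall := KineticFluxLdDecay → RelEntropyVanishing` (`A → B`).

WALL-BREAKER LINE (crux-strategist, generation 1, after the exhausted opening chain: three leads, three checked
skeletons, all dead; lead verdict a1 `misstated` = "A is idle: every checked skeleton proves B outright and carries the
typing-debt stub `A → A⁺`"). The record localises the debt in TWO independent halves
(`Theorems/AntiMazurCoboundariesKineticWindowGronwallKineticClassUpgrade.lean`, `kineticClassUpgrade_of_halves`):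
(W1) AMPLITUDE/CLASS — the bounded class `|g| ≤ κ` cannot feed the heat-flux row of any entropy clock
(Disproof §8 `cubic_budget_diverges`; Osgood exponent 3/2) whereas the Gaussian-dominated quadratic class can
(`quadratic_budget_closes`); (W2/X3) REFERENCE LAW / DENSITY BAND — A speaks of ONE invariant homogeneous Gibbs law at
reduced density `σ³`, the clock runs under local Gibbs references over a band of local reduced densities.

THE DOOR (idea card `Ideas/rare-band-residence-ladder.md`, ideator 2 gen 2 — passed the one triage that saw it,
TRIAGE-r1-1 addendum, never planned into a line before the chain was declared exhausted): the quadratic class is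
EXACTLY the bounded class on the bulk `‖w‖ ≤ V₁` PLUS the RARE BAND (observables vanishing on `‖w‖ ≤ V₁`, quadratic
envelope beyond, amplitude `c⋆`), by ONE Cauchy–Schwarz on the window exponential moment after an exactly
re-orthogonalising cut (the triage / Disproof §10.2 repair: bounded-shell re-orthogonaliser, no residual
functional). Hence the W1 half of the debt is DISCHARGED by `A ∧ RareBandLdDecay` through a provable-now ladder
(`stub_amplitudeLadder`) — A is CONSUMED on the bulk at its own amplitude `κ`, and cannot be deleted
(`RareBandLdDecay` has no member that is nonzero near `w = 0`, so it does not imply A) — while the W2/X3 half is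
isolated in ONE pressure-level class transfer (`stub_localTransfer`, the exact analogue of the board crux TwoClocks
14443 / 16625-S3b, whose target the steered-cascade witness of the dead lines does NOT refute — c1's own scoping note),
and the clock is no longer a stub to invent: it is the LANDED one-window heart of 14680/9133
(`Theorems.HydroLimitInBandOfHeart.hydroLimitInBand_of_heart`: `OneWindowLedger → WindowContinuity → LineInputs →
HydroLimitInBand`), re-run with a product-form kinetic instance and post-composed with dilute self-consistency to
reach `RelEntropyVanishing` VERBATIM (`stub_entropyClockRE`, L-sized). (The heart's two input statements used below,
`LocalClampedTransferWindowLDFamily` and `CoherentSuprathermalContentVanishesW`, are BYTE-IDENTICAL copies of the defs in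
`Theorems/ImplosionDichotomyHydroLimitInBandOfHeart.lean` §2 — copied, not imported, so that this workfile elaborates
independently of that module's build state on the farm; `Iff.rfl` against the originals wherever both are imported.)

What changed w.r.t. the card (forced by the record): (i) the card's bet `RareBandSlaving : A → RareBandLdDecay` is
DROPPED (a1: "a re-typing of 10967 in all but name"; it would also make A's role circular) — `RareBandLdDecay` stands
as the line's load-bearing OPEN stub, with the card's why-easier (packets leave a velocity band after O(1) of their
OWN collisions, residence time `≈ 4ℓ_mf/V` shrinking with `V`: per-packet Lanford trees at fixed `σ`, Gaussian
activity of packet visits); (ii) the downstream is NOT the card's Nachtergaele–Yau bookkeeping with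
`HighMomentumCutoff σ` and `A → ∞` (which races a black-box tails threshold — finding CUTOFF-MATCHING of 14680-c2)
but the landed heart at FIXED cut-off `K⋆` with the weighted coherence input `CoherentSuprathermalContentVanishesW`
and `EnergyCurrentTails` in mean; (iii) the local docking node is typed in PRODUCT FORM in the local thermal frame
(`Σ_i φ(s, x_i) g((v_i − u_s(x_i))/√θ_s(x_i))`, amplitude-first `∃ c⋆` before `(φ, g)`, windows `∃ τ₀ ∀ τ ≥ τ₀`,
`∀ s ∈ [0,t₁]` innermost) — the honest reach of a bounded PRODUCT-class hypothesis (a general continuous profile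
`G(x,|w|²)` has unbounded nuclear rank), and sufficient for the heart, whose members (traceless stress; the
re-orthogonalised low heat-flux cut-off in the THERMAL frame, `G̃` and its compensating amplitude x-INDEPENDENT) have
rank ≤ 9.

Registered stubs (5) and composition `KineticWindowGronwall_of` (sorry-free, concludes the crux BY NAME):
`stub_rareBand` (NEW open lemma, the card's `RareBandLdDecay` verbatim) ; `stub_amplitudeLadder`
(`A → RareBandLdDecay → QuadraticClassLdDecay`, provable now, L) ; `stub_localTransfer`
(`QuadraticClassLdDecay → LocalQuadraticWindowLDFamily`, crux-sized, = the open content of TwoClocks 14443 / 16625-S3b: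
locality of window log-mgfs over one kinetic window + density-band uniformity; frame/functional uniformity and the
window upgrade are PROVED on the sibling item, 16625-S3a Baire theorem + S3x, kernel-checked, landing kit) ; `stub_entropyClockRE` (the landed heart re-run on the
product node, + `DiluteSelfConsistency` glue, concluding `RelEntropyVanishing`; L) ; `stub_sharedInputs` (the heart's
other inputs BY NAME: `LocalClampedTransferWindowLDFamily`, `CoherentSuprathermalContentVanishesW`,
TwoClocks `TransferActivityTails` 16624, `EnergyCurrentTails` 9235, `DiluteSelfConsistency` 3091).

Disproof.lean used (cdisprove cycles 1–3, tree copy 05:08Z 2026-08-16): §1 `not_crux_iff` — the line is "B from A" with A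
load-bearing (composition `fun … hA => h₄ (h₃ (h₂ hA h₁)) …`); §2–§3 HONOURED — `stub_entropyClockRE` concludes
`RelEntropyVanishing` verbatim, tie and balance laws inside the heart (`Negative/ConsequentLoadBearing` imported,
`honours_tie`); §4 HONOURED — nothing cubic is exponentiated: every LD statement of the line is quadratic-class with
`c⋆ < 1/2` (Gaussian), the cubic suprathermal heat flux is paid in mean inside the heart by `EnergyCurrentTails` +
`CoherentSuprathermalContentVanishesW` (`Negative/CubicMomentDiverges` imported, `honours_cubic`); §8 ANSWERED —
`cubic_budget_diverges` is the bounded-class budget, the ladder delivers the quadratic class (`quadratic_budget_closes`),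
and the heart does not even send the cut-off to infinity; §10.1 — amplitude floors `κ_crit = 0.977` (bounded),
`c_crit = 0.177` (quadratic), `c_crit(V₁) = 0.21…0.36 ↑ 1/2` (rare band): all amplitudes here are EXISTENTIAL (`∃ κ`,
`∃ c⋆`), consistent; §10.2 — the ladder's gap-as-worded REPAIRED (bounded-shell re-orthogonaliser, TRIAGE-r1-1);
§5.5 — LD locality is NOT asserted pathwise (no `∀ lam` event bound): it lives inside the pressure-level
`stub_localTransfer`; §7 — activity dummy respected (global statements at one reduced density; the density band is the
transfer's named content, X3). Landed negatives p73911 p74367 p75880 p76324 p76858 p81001: none instantiated.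
-/

noncomputable section

open scoped BigOperators ENNReal Classical
open MeasureTheory Set
open Literature.MathematicalPhysics.KineticTheory Literature.Analysis.FluidPDE Literature.Analysis.FunctionSpaces

namespace Summit.AtomisticToContinuum.HydrodynamicLimit.Cruxes.KineticWindowGronwall.RareBandLadderDock

open Summit.AtomisticToContinuum.HydrodynamicLimit.Theses.AntiMazurCoboundaries
  (KineticFluxLdDecay RelEntropyVanishing KineticWindowGronwall)
open Summit.AtomisticToContinuum.HydrodynamicLimit.Theses.TwoClocks
  (TransferActivityTails EnergyCurrentTails DiluteSelfConsistency)
/-- Sanity: the crux is literally `KineticFluxLdDecay → RelEntropyVanishing`. -/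
example : KineticWindowGronwall = (KineticFluxLdDecay → RelEntropyVanishing) := rfl

/-- Sanity: the shared inputs named below are the board items' own decls (same terms across the sibling routes). -/
example : Theses.TwoClocks.EnergyCurrentTails = Theses.OneFlightGossipEngine.EnergyCurrentTails := rfl

/-! ## §1 Statements -/

/-- The hard-sphere flow of `N+1` spheres at reduced density `σ` on `𝕋³`. -/
abbrev TFlow (σ : ℝ) (N : ℕ) : Type :=
  HardSphereFlow (Torus.geometry (Fin 3)) (hsDiameter σ N) (N + 1)

/-- The orthogonality clause of all kinetic statements of this line (verbatim the clause of `KineticFluxLdDecay`):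
`g ⊥ span{1, w, ‖w‖²}` in `L²(stdGaussian)` — the thermal-frame collision invariants. -/
def Orth (g : V3 → ℝ) : Prop :=
  ∀ (c₀ c₂ : ℝ) (b : V3), ∫ v, g v * (c₀ + inner ℝ b v + c₂ * ‖v‖ ^ 2) ∂(ProbabilityTheory.stdGaussian V3) = 0

/-- **RARE-BAND LD DECAY** — the NEW open lemma of the line (VERBATIM the card's typed `RareBandResidenceLadder.RareBandLdDecay`,
`Cruxes/KineticWindowGronwall/IdeatorTwoSketch-g2.lean`, re-checked rc 0 by TRIAGE-r1-1). Frame of `KineticFluxLdDecay`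
(stmt-10967) with the bounded amplitude clause `∃ κ, |g| ≤ κ` replaced by: `∃ c⋆ > 0, ∃ V₁ > 0` such that for all continuous
`φ, g` with `|φ| ≤ 1`, `|g w| ≤ c⋆ ‖w‖²`, `g = 0` on the bulk ball `‖w‖ ≤ V₁`, `g ⊥ span(1, w, ‖w‖²)`:
`∀ δ > 0 ∃ τ, N₀ ∀ N ≥ N₀ ∀ Φ: ∫ exp(h⁻¹∫₀ʰ Σᵢ φ(xᵢ(s)) g((vᵢ(s) − u₀)/√θ) ds) dG_N ≤ e^{δ(N+1)}`, `h = τ(N+1)^{-1/3}`.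
Finite statically for `c⋆ < 1/2`; Donsker–Varadhan floor `c⋆ < c_crit(V₁) ∈ [0.21, 0.5)` (Disproof §10.1) — `c⋆` is
existential, so consistent. STRICTLY WEAKER than the quadratic re-typing of 10967 and NOT implying the bounded one
(no member of the class is nonzero near `w = 0`): the far Maxwellian tail of the ONE-BODY velocity law, whose carriers are
fast packets (density `e^{-V₁²/2}`, never meeting each other) relaxing after O(1) of their OWN collisions — per-packet
Lanford trees at fixed `σ`, expansion parameter `v̄/V`, not the density (card §Lever, §Why-easier). The classes shrink as
`V₁ ↑`, `c⋆ ↓`, and the ladder works for ANY `(c⋆, V₁)`, so the statement is needed only EVENTUALLY in `V₁`. -/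
def RareBandLdDecay : Prop :=
  ∀ (a θ : ℝ) (u₀ : V3), 0 < a → 0 < θ → ∃ σ₀ : ℝ, 0 < σ₀ ∧
    ∀ σ : ℝ, 0 < σ → σ < σ₀ →
    (∀ (N : ℕ) (Φ : TFlow σ N),
      IsProbabilityMeasure (localGibbsLaw σ (fun _ => a) (fun _ => u₀) (fun _ => θ) N Φ)) ∧
    ∃ cstar : ℝ, 0 < cstar ∧ ∃ V₁ : ℝ, 0 < V₁ ∧
    ∀ (φ : T3 → ℝ) (g : V3 → ℝ), Continuous φ → Continuous g → (∀ x, |φ x| ≤ 1) →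
      (∀ v, |g v| ≤ cstar * ‖v‖ ^ 2) → (∀ v, ‖v‖ ≤ V₁ → g v = 0) → Orth g →
      ∀ δ : ℝ, 0 < δ → ∃ τ : ℝ, 0 < τ ∧ ∃ N₀ : ℕ, ∀ N : ℕ, N₀ ≤ N → ∀ Φ : TFlow σ N,
        ∫⁻ z, ENNReal.ofReal (Real.exp ((τ * ((N + 1 : ℕ) : ℝ) ^ (-(1 / 3 : ℝ)))⁻¹ *
            ∫ s in (0 : ℝ)..(τ * ((N + 1 : ℕ) : ℝ) ^ (-(1 / 3 : ℝ))),
              ∑ i, φ (Φ.flow s z i).1 * g ((Real.sqrt θ)⁻¹ • ((Φ.flow s z i).2 - u₀))))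
          ∂(localGibbsLaw σ (fun _ => a) (fun _ => u₀) (fun _ => θ) N Φ)
        ≤ ENNReal.ofReal (Real.exp (δ * (N + 1)))

/-- **QUADRATIC-CLASS LD DECAY AT GLOBAL EQUILIBRIUM** (VERBATIM the card's `RareBandResidenceLadder.QuadraticClassLdDecay`;
= `KineticFluxLdDecay` with the bounded class replaced by the Gaussian-dominated quadratic class `|g w| ≤ c⋆(1 + ‖w‖²)`,
amplitude `c⋆` AFTER `σ` — the honest reach of `A ∧ RareBandLdDecay`; the `κ`-before-`σ` / `σ`-locally-uniform variants
`KineticFluxLdDecayQuad(LocUnif)` of the dead skeletons are NOT claimed: their extra content is the density-band half X3,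
which this line puts inside `stub_localTransfer`). Frame-universality (`σ₀` first, one `c⋆(σ)` for every frame) is a landed
equivalence for this class (`KineticWindowGronwallFrameCovQ.kineticFluxLdDecayQuad_iff_univ` pattern, p118022). -/
def QuadraticClassLdDecay : Prop :=
  ∀ (a θ : ℝ) (u₀ : V3), 0 < a → 0 < θ → ∃ σ₀ : ℝ, 0 < σ₀ ∧
    ∀ σ : ℝ, 0 < σ → σ < σ₀ →
    (∀ (N : ℕ) (Φ : TFlow σ N),
      IsProbabilityMeasure (localGibbsLaw σ (fun _ => a) (fun _ => u₀) (fun _ => θ) N Φ)) ∧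
    ∃ cstar : ℝ, 0 < cstar ∧
    ∀ (φ : T3 → ℝ) (g : V3 → ℝ), Continuous φ → Continuous g → (∀ x, |φ x| ≤ 1) →
      (∀ v, |g v| ≤ cstar * (1 + ‖v‖ ^ 2)) → Orth g →
      ∀ δ : ℝ, 0 < δ → ∃ τ : ℝ, 0 < τ ∧ ∃ N₀ : ℕ, ∀ N : ℕ, N₀ ≤ N → ∀ Φ : TFlow σ N,
        ∫⁻ z, ENNReal.ofReal (Real.exp ((τ * ((N + 1 : ℕ) : ℝ) ^ (-(1 / 3 : ℝ)))⁻¹ *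
            ∫ s in (0 : ℝ)..(τ * ((N + 1 : ℕ) : ℝ) ^ (-(1 / 3 : ℝ))),
              ∑ i, φ (Φ.flow s z i).1 * g ((Real.sqrt θ)⁻¹ • ((Φ.flow s z i).2 - u₀))))
          ∂(localGibbsLaw σ (fun _ => a) (fun _ => u₀) (fun _ => θ) N Φ)
        ≤ ENNReal.ofReal (Real.exp (δ * (N + 1)))

/-- **THE DOCKING NODE OF THIS LINE: local quadratic-class window LD in PRODUCT FORM along families.** For jointly
continuous one-parameter families of positive profiles `s ↦ (a_s, θ_s, u_s)` on `[0, t₁]` obeying the `η₀`-activity-ratio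
packing guard (the guard of TwoClocks' `KineticWindowLDUniform` / the heart's `KineticCurrentsWindowLDFamily`), at reduced
density parameter `σ`, there is ONE amplitude `c⋆ > 0` (after `σ` and the family, BEFORE the flow family and the observable)
such that for every jointly continuous space-time weight `|φ| ≤ 1` and every continuous thermal-frame profile `g`,
`|g w| ≤ c⋆(1 + ‖w‖²)`, `g ⊥ span(1, w, ‖w‖²)` under the standard Gaussian: `∀ ε ∃ τ₀ ∀ τ ≥ τ₀ ∃ N₀ ∀ N ≥ N₀ ∀ s ∈ [0,t₁]`,
`∫ exp(Σᵢ w_N⁻¹∫₀^{w_N} φ(s, xᵢ(r)) g((vᵢ(r) − u_s(xᵢ(r)))/√θ_s(xᵢ(r))) dr) dλ^N_s ≤ e^{ε(N+1)}`, `w_N = τ(N+1)^{-1/3}`,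
`λ^N_s = localGibbsLaw σ a_s u_s θ_s N (Φ N)`. WHY THIS SHAPE: (a) product form in the local THERMAL frame is what a bounded
PRODUCT-class hypothesis can reach (the ladder is rank-one by rank-one; a general continuous radial profile `G(x,·)` has
unbounded nuclear rank) and it suffices for the heart, whose kinetic members are finite sums of such products with
x-INDEPENDENT `g` — the traceless thermal stress `w̃ⱼw̃ₖ − δⱼₖ‖w̃‖²/3` (rank ≤ 5) and the re-orthogonalised low heat-flux
cut-off `w̃ⱼ G̃(‖w̃‖²)` with `G̃(r) = (r − 5)χ(r) + c̃ψ(r)`, `c̃` a CONSTANT in the thermal frame (rank 3; its complement vanishes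
for `‖w̃‖ ≤ K̃`, i.e. below the lab threshold `K⋆ = K̃√θ_min`, as `CoherentSuprathermalContentVanishesW` requires of its weight
`R(s,x,·)`); finite sums enter the heart through Hölder at amplitude `c⋆/rank`; (b) amplitude-first and `s`-innermost is the
family-uniform typing an entropy clock along a time-dependent reference CAN consume (UNIFORMITY finding 9133/14680-c2; at
fixed density the functional/frame directions are uniform for free by the PROVED Baire theorem 16625-S3a (kernel-checked, landing kit), so the only
non-trivial uniformity asked here beyond the pointwise global node is the DENSITY BAND, X3); (c) `∃ τ₀ ∀ τ ≥ τ₀` so that all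
channels of the ledger run on one window (upgrade 16625-S3x at equilibrium, proved; pattern = landed WindowSubadditivity p103614). Conjecture-grade (open-problem): it
contains the pointwise local node restricted to product members. -/
def LocalQuadraticWindowLDFamily : Prop :=
  ∃ η₀ : ℝ, 0 < η₀ ∧ ∀ (t₁ : ℝ) (a θ₀ : ℝ → T3 → ℝ) (u₀ : ℝ → T3 → V3),
    Continuous (Function.uncurry a) → Continuous (Function.uncurry θ₀) → Continuous (Function.uncurry u₀) →
    (∀ s x, 0 < a s x) → (∀ s x, 0 < θ₀ s x) →
    ∀ σ : ℝ, 0 < σ → (∀ s ∈ Set.Icc 0 t₁, σ ^ 3 * (⨆ x, a s x) ≤ η₀ * ∫ x, a s x) →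
    ∃ cstar : ℝ, 0 < cstar ∧
    ∀ Φ : (N : ℕ) → TFlow σ N,
    ∀ (φ : ℝ → T3 → ℝ) (g : V3 → ℝ), Continuous (Function.uncurry φ) → Continuous g →
      (∀ s x, |φ s x| ≤ 1) → (∀ w, |g w| ≤ cstar * (1 + ‖w‖ ^ 2)) → Orth g →
      ∀ ε : ℝ, 0 < ε → ∃ τ₀ : ℝ, 0 < τ₀ ∧ ∀ τ : ℝ, τ₀ ≤ τ → ∃ N₀ : ℕ, ∀ N : ℕ, N₀ ≤ N →
      ∀ s ∈ Set.Icc 0 t₁,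
        ∫⁻ z, ENNReal.ofReal (Real.exp (∑ i : Fin (N + 1),
            (τ * ((N : ℝ) + 1) ^ (-(1 / 3 : ℝ)))⁻¹ *
              ∫ r in (0 : ℝ)..(τ * ((N : ℝ) + 1) ^ (-(1 / 3 : ℝ))),
                φ s ((Φ N).flow r z i).1 *
                  g ((Real.sqrt (θ₀ s ((Φ N).flow r z i).1))⁻¹ •
                    (((Φ N).flow r z i).2 - u₀ s ((Φ N).flow r z i).1))))
          ∂(localGibbsLaw σ (a s) (u₀ s) (θ₀ s) N (Φ N)) ≤
        ENNReal.ofReal (Real.exp (ε * ((N : ℝ) + 1)))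

/-- **THE AMPLITUDE LADDER** (VERBATIM the card's `AmplitudeLadder`; provable now, L): the bounded class (crux antecedent
`KineticFluxLdDecay`, amplitude `κ(σ)`) and the rare band (`RareBandLdDecay`, amplitude `c⋆` beyond `V₁`) give the quadratic
class with constant `≍ min(c⋆, κ)/(1 + V₁²)` up to Gram-matrix factors. Proof plan (TRIAGE-r1-1 / Disproof §10.2 repair built
in): fix the GIVEN `V₁`; continuous cut-off `χ = 1` on `‖w‖ ≤ V₁`, `0` beyond `V₁ + 1`; re-orthogonaliser
`ν = Σⱼ aⱼ ψⱼ ζ(‖w‖)` on the BOUNDED SHELL `V₁ < ‖w‖ < V₁ + 2` (`ψ = (1, wₖ, ‖w‖²)`, `ζ` a continuous bump vanishing on `[0, V₁]`;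
Gram matrix `∫ ψⱼψₖ ζ dγ` nonsingular; `a = Gram⁻¹⟨gχ, ψ⟩ = −Gram⁻¹⟨g(1−χ), ψ⟩ = O(c⋆_Q)` by `Orth g`); then `G₁ := gχ − ν` is
BOUNDED, continuous and orthogonal (bounded class at amplitude `κ/(2 sup|G₁|)`), `G₂ := g(1 − χ) + ν` vanishes on `‖w‖ ≤ V₁`, is
continuous, orthogonal and `|G₂ w| ≤ C ‖w‖²` on its support — NO residual functional; upgrade both hypotheses' windows from
`∃ τ` to `∃ τ₀ ∀ τ ≥ τ₀` (landed `WindowSubadditivity` p103614 + static Gaussian bound: `Λ_τ ≤ (mτ₁/τ)Λ_{τ₁} + (r/τ)Λ_static`),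
take a common window, Cauchy–Schwarz on the `lintegral` (`ENNReal.lintegral_mul_le_Lp_mul_Lq`), linearity of the window
functional on the good set (velocities piecewise constant, finitely many jumps: `HardSphereFlowMeasurable`). -/
def AmplitudeLadder : Prop :=
  KineticFluxLdDecay → RareBandLdDecay → QuadraticClassLdDecay

/-- **THE LOCAL TRANSFER** (crux-sized; the SHARED kinetic wall in its transfer form = the open content of TwoClocks
crux 5 `LocalGibbsTransfer` (stmt-14443) and of 16625's upgrade stub S3b `EquilibriumKineticLDFamily → KineticCurrentsWindowLDFamily`,
restricted to product members): quadratic-class window LD at global equilibrium, pointwise in `σ`, ⟹ the local product node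
along families. Content, audited against the record: (i) LOCALITY of window log-mgfs over ONE kinetic window (`h = τℓ → 0`
macroscopically) under the hard-core local Gibbs law — cells/corridors at the PRESSURE level (TwoClocks 14443's intended
proof; 14680/9133 "gap #3"); NOT the pathwise `∀ lam` influence-locality event bound that killed dlr-block-transfer /
self-similar-block-periodisation (`stub_collarLocality`, steered dispersal cascades) — that witness refutes the proof CURRENCY of
a forecast-factorised transfer at fixed amplitude over growing windows, not this target (c1's cross-route note,
`Lines/dlr-block-transfer-dead.md` §Cross-route); (ii) DENSITY-BAND UNIFORMITY (X3/BN3/S2): the local reference meets the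
global hypothesis at the continuum of reduced densities `σρ̂^{1/3}`, and pointwise thresholds `c⋆(σ'), τ(σ'), N₀(σ')` do not
net over a band by logic ("comparison systems at σρ₀(x)^{1/3} ≠ σ; no structure known", 16625 lead) — as for 14443, the
expected proof RE-RUNS the global engine cell-wise rather than consuming it as a black box; (iii) functional/frame uniformity
and (iv) the window upgrade `∃τ ⇒ ∃τ₀ ∀τ ≥ τ₀` are NOT content: PROVED at equilibrium on the sibling item (16625-S3a
`stub_equilibriumFamily`, Baire on the Banach space of admissible profiles + exact activity/boost/thermal covariance; S3x
`stub_windowUpgrade`; kernel-checked, landing kit `Cruxes/TransferEntropyClock/LANDING-KIT.md`).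
An implication between two open statements: not refutable short of its antecedent; its risk is provability. -/
def LocalTransferQ : Prop :=
  QuadraticClassLdDecay → LocalQuadraticWindowLDFamily

/-- **[BYTE-IDENTICAL COPY of `Theorems.HydroLimitInBandOfHeart.CoherentSuprathermalContentVanishesW` (v9) = the 14680
skeleton's S6′]** The weighted coherence input of the heart (finding CUTOFF-MATCHING of lead 14680-c2): along the TRUE evolution from the
local Gibbs datum, at a FIXED suprathermal threshold `K⋆`, for every bounded measurable radial weight `R(s,x,·)` vanishing below `K⋆²`,
the suprathermal cubic content carried by `(η, R)`-coherent particles vanishes in mean as `τ → ∞`. Frame of `EnergyCurrentTails`. -/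
def CoherentSuprathermalContentVanishesW : Prop :=
  ∀ (a₀ θ₀ : T3 → ℝ) (u₀ : T3 → V3), Continuous a₀ → Continuous θ₀ → Continuous u₀ →
    (∀ x, 0 < a₀ x) → (∀ x, 0 < θ₀ x) →
    ∃ σ₀ : ℝ, 0 < σ₀ ∧ ∀ σ : ℝ, 0 < σ → σ < σ₀ →
    ∀ (T : ℝ) (ρ θ : ℝ → T3 → ℝ) (u : ℝ → T3 → V3), IsHardSphereEulerSolution σ T ρ u θ →
    ∀ Φ : (N : ℕ) → HardSphereFlow (Torus.geometry (Fin 3)) (hsDiameter σ N) (N + 1),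
    TendstoHydroFieldsAt (fun N => localGibbsLaw σ a₀ u₀ θ₀ N (Φ N)) Φ ρ u θ 0 →
    ∀ t ∈ Set.Ico 0 T, ∃ Kstar : ℝ, 0 < Kstar ∧
    ∀ R : ℝ → T3 → ℝ → ℝ, Measurable (fun p : ℝ × T3 × ℝ => R p.1 p.2.1 p.2.2) →
    (∀ s x s', s' ≤ Kstar ^ 2 → R s x s' = 0) → (∀ s x s', |R s x s'| ≤ |s'|) →
    ∀ η : ℝ, 0 < η → ∀ ε : ℝ, 0 < ε →
    ∃ τ₀ : ℝ, 0 < τ₀ ∧ ∀ τ : ℝ, τ₀ ≤ τ → ∃ N₀ : ℕ, ∀ N : ℕ, N₀ ≤ N → ∀ s ∈ Set.Icc 0 t,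
      (let w : ℝ := τ * ((N : ℝ) + 1) ^ (-(1 / 3 : ℝ))
       let P := localGibbsLaw σ a₀ u₀ θ₀ N (Φ N)
       let W := fun (i : Fin (N + 1)) (s r : ℝ) (z : Config (N + 1) (Fin 3) T3) =>
         ((Φ N).flow r z i).2 - u s ((Φ N).flow r z i).1
       let cub := fun (i : Fin (N + 1)) (s : ℝ) (z : Config (N + 1) (Fin 3) T3) =>
         w⁻¹ * ∫ r in s..(s + w), ‖W i s r z‖ ^ 3
       let cubHi := fun (i : Fin (N + 1)) (s : ℝ) (z : Config (N + 1) (Fin 3) T3) =>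
         w⁻¹ * ∫ r in s..(s + w), (if Kstar < ‖W i s r z‖ then ‖W i s r z‖ ^ 3 else 0)
       let qbar := fun (i : Fin (N + 1)) (s : ℝ) (z : Config (N + 1) (Fin 3) T3) =>
         w⁻¹ • ∫ r in s..(s + w), (R s ((Φ N).flow r z i).1 (‖W i s r z‖ ^ 2)) • W i s r z
       ∫⁻ z, ENNReal.ofReal (((N : ℝ) + 1)⁻¹ * ∑ i : Fin (N + 1),
              (if η * cub i s z < ‖qbar i s z‖ then cubHi i s z else 0)) ∂P ≤ ENNReal.ofReal ε)

/-- **[BYTE-IDENTICAL COPY of `Theorems.HydroLimitInBandOfHeart.LocalClampedTransferWindowLDFamily` (v8) = the 14680 skeleton's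
family node]** The LOCAL transfer-clamped collisional window LD along families: the localisation, along jointly continuous families of
profiles with the `η₀`-activity-ratio guard, of TwoClocks' repaired collisional crux C′ (`ClampedTransferWindowLD`, stmt-16623:
pair-symmetric momentum+energy TRANSFER-activity clamp, EOS-projected rows, deterministic centring; the momentum-only clamp 13733 is
refuted and is NOT this statement). Thresholds `V₀, β₀, τ₀, N₀` uniform, `∀ s ∈ [0,t₁]` innermost. -/
def LocalClampedTransferWindowLDFamily : Prop :=
  ∃ η₀ : ℝ, 0 < η₀ ∧ ∀ (t₁ : ℝ) (a θ₀ : ℝ → T3 → ℝ) (u₀ : ℝ → T3 → V3) (ha : ∀ s, Continuous (a s)),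
    Continuous (Function.uncurry a) → Continuous (Function.uncurry θ₀) → Continuous (Function.uncurry u₀) →
    ∀ (ha0 : ∀ s x, 0 < a s x), (∀ s x, 0 < θ₀ s x) → ∀ σ : ℝ, 0 < σ → σ < 1 / 2 →
    (∀ s ∈ Set.Icc 0 t₁, σ ^ 3 * (⨆ x, a s x) ≤ η₀ * ∫ x, a s x) →
    ∀ Φ : (N : ℕ) → HardSphereFlow (Torus.geometry (Fin 3)) (hsDiameter σ N) (N + 1),
    ∀ φ : ℝ → T3 → ℝ, Torus.IsSmoothSpaceTimeOn (Set.Icc 0 t₁) φ →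
    ∃ V₀ : ℝ, 0 < V₀ ∧ ∀ V : ℝ, V₀ ≤ V → ∃ β₀ : ℝ, 0 < β₀ ∧ ∀ β : ℝ, |β| ≤ β₀ → ∀ ε : ℝ, 0 < ε →
    ∃ τ₀ : ℝ, 0 < τ₀ ∧ ∀ τ : ℝ, τ₀ ≤ τ → ∃ N₀ : ℕ, ∀ N : ℕ, N₀ ≤ N → ∀ s ∈ Set.Icc 0 t₁,
      (let ρ₀ : T3 → ℝ := rhoLim (profileOf (a s) (ha s) (ha0 s)) σ
       let w : ℝ := τ * ((N : ℝ) + 1) ^ (-(1 / 3 : ℝ))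
       let P := localGibbsLaw σ (a s) (u₀ s) (θ₀ s) N (Φ N)
       let Z : T3 → ℝ := fun x => hsCompressibility (ρ₀ x * σ ^ 3)
       let Z' : T3 → ℝ := fun x => deriv hsCompressibility (ρ₀ x * σ ^ 3)
       let act := fun (i : Fin (N + 1)) (z : Config (N + 1) (Fin 3) T3) =>
         σ / τ * (Φ N).collisionSum (Set.Ioc 0 w) (fun c => if c.fst = i then
           ‖c.postVel.1 - c.preVel.1‖ + |‖c.postVel.1‖ ^ 2 - ‖c.preVel.1‖ ^ 2| / 2 else 0) z
       let ω := fun (i : Fin (N + 1)) (z : Config (N + 1) (Fin 3) T3) => if act i z ≤ V then (1 : ℝ) else 0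
       let Xm := fun (k : Fin 3) (z : Config (N + 1) (Fin 3) T3) =>
         (Φ N).collisionSum (Set.Ioc 0 w)
           (fun c => ω c.fst z * ω c.snd z * ((φ s c.fstPos - φ s c.sndPos) * (c.postVel.1 k - c.preVel.1 k)) / 2) z
       let Am := fun (k : Fin 3) (z : Config (N + 1) (Fin 3) T3) =>
         (∫ r in (0 : ℝ)..w, ∑ i : Fin (N + 1), Torus.partialDeriv k (φ s) ((Φ N).flow r z i).1 *
           (θ₀ s ((Φ N).flow r z i).1 * (ρ₀ ((Φ N).flow r z i).1 * σ ^ 3) * Z' ((Φ N).flow r z i).1 +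
             (1 / 3) * (Z ((Φ N).flow r z i).1 - 1) * ‖((Φ N).flow r z i).2 - u₀ s ((Φ N).flow r z i).1‖ ^ 2)) -
         w * ((N : ℝ) + 1) * ∫ x, ρ₀ x * Torus.partialDeriv k (φ s) x * (θ₀ s x * (ρ₀ x * σ ^ 3) * Z' x)
       let Xe := fun (z : Config (N + 1) (Fin 3) T3) =>
         (Φ N).collisionSum (Set.Ioc 0 w)
           (fun c => ω c.fst z * ω c.snd z *
             ((φ s c.fstPos - φ s c.sndPos) * ((‖c.postVel.1‖ ^ 2 - ‖c.preVel.1‖ ^ 2) / 2)) / 2) z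
       let Ae := fun (z : Config (N + 1) (Fin 3) T3) =>
         (∫ r in (0 : ℝ)..w, ∑ i : Fin (N + 1),
           ((∑ l : Fin 3, u₀ s ((Φ N).flow r z i).1 l * Torus.partialDeriv l (φ s) ((Φ N).flow r z i).1) *
               (θ₀ s ((Φ N).flow r z i).1 * (ρ₀ ((Φ N).flow r z i).1 * σ ^ 3) * Z' ((Φ N).flow r z i).1 +
                 (1 / 3) * (Z ((Φ N).flow r z i).1 - 1) * ‖((Φ N).flow r z i).2 - u₀ s ((Φ N).flow r z i).1‖ ^ 2) +
             θ₀ s ((Φ N).flow r z i).1 * (Z ((Φ N).flow r z i).1 - 1) *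
               (∑ l : Fin 3, Torus.partialDeriv l (φ s) ((Φ N).flow r z i).1 *
                 (((Φ N).flow r z i).2 - u₀ s ((Φ N).flow r z i).1) l))) -
         w * ((N : ℝ) + 1) *
           ∫ x, ρ₀ x * (∑ l : Fin 3, u₀ s x l * Torus.partialDeriv l (φ s) x) * (θ₀ s x * (ρ₀ x * σ ^ 3) * Z' x)
       (∀ k : Fin 3, ∫⁻ z, ENNReal.ofReal (Real.exp (β * (w⁻¹ * Xm k z - w⁻¹ * Am k z))) ∂P ≤
           ENNReal.ofReal (Real.exp (ε * ((N : ℝ) + 1)))) ∧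
         ∫⁻ z, ENNReal.ofReal (Real.exp (β * (w⁻¹ * Xe z - w⁻¹ * Ae z))) ∂P ≤
           ENNReal.ofReal (Real.exp (ε * ((N : ℝ) + 1))))

/-- **THE ENTROPY CLOCK TO `RelEntropyVanishing` FROM THE LANDED HEART** (L; NOT a new ledger). Antecedents: the local
product node of this line; the heart's family-uniform LOCAL clamped collisional-transfer window LD
(`HydroLimitInBandOfHeart.LocalClampedTransferWindowLDFamily`, the localisation of TwoClocks' repaired C′ 16623); the weighted
coherence input `CoherentSuprathermalContentVanishesW` (14680-c2 finding CUTOFF-MATCHING: at FIXED `K⋆` the suprathermal heat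
flux is paid in mean by directional decorrelation + `EnergyCurrentTails`, so no cut-off races a threshold); TwoClocks'
`TransferActivityTails` (16624; splits into CAT ∧ CEAT, landed `stub_transferTailsSplit` / `activityTails_of_transferActivityTails`),
`EnergyCurrentTails` (9235) and `DiluteSelfConsistency` (3091). Proof plan: (1) KINETIC INSTANCE on the product node — the
heart consumes its kinetic input only at finite sums of thermal-frame products (traceless stress, rank ≤ 5; re-orthogonalised
low heat-flux cut-off `w̃ⱼG̃(‖w̃‖²)`, rank 3, `G̃` and `c̃` x-independent in the thermal frame; weights `θ_s^{3/2}∂ⱼ(1/θ_s)`,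
`∂ₖu_s` continuous on `[0,t₁] × 𝕋³`), Hölder over the rank at amplitude `c⋆/rank` — a re-run of the landed
`OneFlightGossipEngineClampedCurrentsDockKineticInstance` with `LoHeatFluxCutoffFamily` built in the thermal frame; (2) the landed
heart `OneWindowLedger` (nine `ClampedCurrentsDockHeart*` files) + `WindowContinuity` (p118327) ⟹ `GronwallCoreInBand`
(`HydroLimitInBandOfHeart.gronwallCoreInBand_of_heart`, landed) — the guarded Grönwall core along the explicit reference
`a_t = ρ_t Rf(σ³ρ_t)`; (3) UNGUARD with `DiluteSelfConsistency`: every tied classical solution stays in the band `ρ_tσ³ < η_c`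
below `σ₀(η_c, profiles)`, so the core applies to ALL solutions quantified by `RelEntropyVanishing`; the three static clauses of
the target (probability, exponential concentration of the reference, `klDiv/(N+1) → 0`) by the landed pattern
`JaynesSqueezeBlockGibbsToRelEntropyReduction.relEntropyVanishing_of_klCore` / `TwoClocksClampedWindowDockGronwall`
(statics `UniformLocalGibbsConcentration`, `HsEosLowDensity` PROVED). Concludes the crux's consequent VERBATIM (Disproof §2–§3:
tie and balance laws are inside the heart's `TimeZeroReference` / `EulerCancellation`). -/
def EntropyClockRE : Prop :=
  LocalQuadraticWindowLDFamily → LocalClampedTransferWindowLDFamily → CoherentSuprathermalContentVanishesW →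
    TransferActivityTails → EnergyCurrentTails → DiluteSelfConsistency → RelEntropyVanishing

/-- **THE SHARED INPUTS OF THE HEART, BY NAME** (one registered stub for the five conjecture-grade inputs this line does NOT
attack — each is a board item or a filed split child of the sibling chains 14680 / 9133 / 16625, staffed there): the local
clamped collisional-transfer window LD along families (localisation of C′ 16623; 16625-S4), the weighted coherence input
(16625-S5 / card `coherence-not-tails`), TwoClocks' transfer-activity tails 16624, the cubic energy-current tails 9235 and dilute
self-consistency 3091. -/
def SharedInputs : Prop :=
  LocalClampedTransferWindowLDFamily ∧ CoherentSuprathermalContentVanishesW ∧ TransferActivityTails ∧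
    EnergyCurrentTails ∧ DiluteSelfConsistency

/-! ## §1a Statement added by v6 (lead c4): the transfer from the board crux 14440 -/

/-- **THE LOCAL TRANSFER FROM THE BOARD** (v6; NOT a registered stub — the dockable form of `LocalTransferQ` recommended for promotion):
`EquilibriumFastWindowLD (14440) → LocalQuadraticWindowLDFamily`. WEAKER than the registered `LocalTransferQ` (its hypothesis is stronger:
`QuadraticClassLdDecay ⇐ EquilibriumFastWindowLD` by the landed dock, `localTransferE_of_localTransferQ` below), with the SAME residual content
((i) one-window pressure-level locality under the x-dependent hard-core local Gibbs law, (ii) density-band uniformity, (iii) s-uniformity and the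
window upgrade under a non-invariant reference), and the form a closed TwoClocks 14443 (`EquilibriumFastWindowLD → KineticWindowLDUniform`) plus
(iii)-glue would deliver — whereas `LocalTransferQ` would in addition need the non-formal converse `QuadraticClassLdDecay → EquilibriumFastWindowLD`
(wave-1 dock audit). It suffices for the crux (`KineticWindowGronwall_of_board'`, A idle given 14440). -/
def LocalTransferE : Prop :=
  Summit.AtomisticToContinuum.HydrodynamicLimit.Theses.TwoClocks.EquilibriumFastWindowLD → LocalQuadraticWindowLDFamily

/-! ## §1b Statements added by the v2 reshape (lead c3) -/

/-- **THE RE-ORTHOGONALISING CUT** (static; pure Gaussian analysis, the TRIAGE-r1-1 / Disproof §10.2 repair as a lemma):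
for every bulk radius `V₁ > 0` there is a constant `K = K(V₁) > 0` such that every continuous `g` of quadratic growth
`|g w| ≤ c (1 + ‖w‖²)` with `g ⊥ span(1, w, ‖w‖²)` splits as `g = G₁ + G₂` with `G₁` continuous, BOUNDED by `K c` and
orthogonal, and `G₂` continuous, orthogonal, VANISHING on the bulk ball `‖w‖ ≤ V₁` and with `|G₂ w| ≤ K c ‖w‖²`. Proof plan:
continuous cut-off `χ = 1` on `‖w‖ ≤ V₁`, `0` beyond `V₁ + 1`; re-orthogonaliser `ν = Σⱼ aⱼ ψⱼ ζ` supported in the bounded shell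
`V₁ < ‖w‖ < V₁ + 2` (`ψ = (1, w₁, w₂, w₃, ‖w‖²)`, `ζ ≥ 0` a continuous radial bump vanishing on `[0, V₁]`; the linear map
`a ↦ (⟨Σⱼ aⱼψⱼζ, ψₖ⟩_γ)ₖ` is injective — `⟨ν, Σ aₖψₖ⟩ = ∫ (Σ aⱼψⱼ)² ζ dγ = 0` forces the polynomial to vanish on the open shell —
hence invertible with a bounded inverse; or explicitly: with `ζ` radial the Gram matrix is block-diagonal by oddness, the `{1, ‖w‖²}`
block nonsingular by Cauchy–Schwarz); `a := Gram⁻¹ ⟨gχ, ψ⟩`, `|⟨gχ, ψₖ⟩| ≤ c ∫ (1 + ‖w‖²)|ψₖ| dγ`; `G₁ := gχ − ν`, `G₂ := g(1 − χ) + ν`. -/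
def ReorthogonalisingCut : Prop :=
  ∀ V₁ : ℝ, 0 < V₁ → ∃ K : ℝ, 0 < K ∧
    ∀ (c : ℝ) (g : V3 → ℝ), 0 ≤ c → Continuous g → (∀ w, |g w| ≤ c * (1 + ‖w‖ ^ 2)) → Orth g →
      ∃ G₁ G₂ : V3 → ℝ, Continuous G₁ ∧ Continuous G₂ ∧ (∀ w, g w = G₁ w + G₂ w) ∧
        (∀ w, |G₁ w| ≤ K * c) ∧ Orth G₁ ∧
        (∀ w, ‖w‖ ≤ V₁ → G₂ w = 0) ∧ (∀ w, |G₂ w| ≤ K * c * ‖w‖ ^ 2) ∧ Orth G₂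

/-- **THE LADDER ASSEMBLY** (measure-theoretic half of the amplitude ladder): given the cut, the bounded class (the crux's antecedent,
USED at its own amplitude `κ` on `G₁`) and the rare band (on `G₂`) give the quadratic class. Proof plan: for `δ > 0` run A and the rare
band at `δ/4`; upgrade both windows `∃τ ⇒ ∀τ ≥ τ₀` (landed `KineticWindowGronwallWindowSubadditivity.lintegral_exp_window_mul_le_of_aemeasurable`
/ `lintegral_exp_window_add_le_of_aemeasurable` + Jensen-in-time static bounds `Λ_r ≤ Λ_static`, bounded resp. Gaussian-quadratic
`KineticWindowGronwallQuadraticMoment.lintegral_exp_quadratic_localGibbsLaw_le`; invariance `measurePreserving_flow_localGibbsLaw_const`,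
`ae_mem_good_localGibbsLaw`); take the common window; split the window functional on good orbits (interval integrability: orbit
measurable in time, velocities bounded by energy conservation); Cauchy–Schwarz `ENNReal.lintegral_mul_norm_pow_le` (½, ½);
amplitude `c⋆_Q := min(κ, c⋆) / (2K)`. -/
def LadderAssembly : Prop :=
  ReorthogonalisingCut → AmplitudeLadder

/-- **THE OUTPUT OF THE LANDED KINETIC INSTANCE KC1** — VERBATIM the conclusion of
`Theorems.ClampedCurrentsDockKineticInstance.KineticInstance` (= `KineticCurrentsWindowLDFamily → LoHeatFluxCutoffFamily → THIS`, see the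
`rfl` example below): along every reference family `(a, θ, u)` continuous/smooth on the slab `[0,t₁] × 𝕋³` obeying the `ηK` packing guard,
for every suprathermal threshold `K⋆` there is a continuous bounded radial profile `G` equal to `s' − 5θ` below `K⋆²` such that the window
exponential moment of the traceless-thermal-stress + re-orthogonalised low heat-flux member `lo` is `≤ e^{ε(N+1)}` for `|β| ≤ β₀`,
`τ ≥ τ₀`, `N ≥ N₀`, uniformly in `s ∈ [0,t₁]`. This is the ONLY form in which the heart's window clause consumes its kinetic input. -/
def KineticInstanceOut : Prop :=
  ∃ ηK : ℝ, 0 < ηK ∧ ∀ (t₁ : ℝ) (a θ : ℝ → T3 → ℝ) (u : ℝ → T3 → V3), 0 ≤ t₁ →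
    ContinuousOn (Function.uncurry a) (Set.Icc 0 t₁ ×ˢ Set.univ) → (∀ s ∈ Set.Icc 0 t₁, ∀ x, 0 < a s x) →
    Torus.IsSmoothSpaceTimeOn (Set.Icc 0 t₁) θ → Torus.IsSmoothSpaceTimeOn (Set.Icc 0 t₁) u →
    (∀ s ∈ Set.Icc 0 t₁, ∀ x, 0 < θ s x) →
    ∀ σ : ℝ, 0 < σ → (∀ s ∈ Set.Icc 0 t₁, σ ^ 3 * (⨆ x, a s x) ≤ ηK * ∫ x, a s x) →
    ∀ Φ : (N : ℕ) → HardSphereFlow (Torus.geometry (Fin 3)) (hsDiameter σ N) (N + 1),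
    ∀ Kstar : ℝ, 0 < Kstar →
    ∃ G : ℝ → T3 × ℝ → ℝ, ContinuousOn (Function.uncurry G) (Set.Icc 0 t₁ ×ˢ Set.univ) ∧
      (∃ C : ℝ, ∀ s ∈ Set.Icc 0 t₁, ∀ y : T3 × ℝ, 0 ≤ y.2 → |G s y| ≤ C) ∧
      (∀ s ∈ Set.Icc 0 t₁, ∀ (x : T3) (s' : ℝ), s' ≤ Kstar ^ 2 → G s (x, s') = s' - 5 * θ s x) ∧
      ∃ β₀ : ℝ, 0 < β₀ ∧ ∀ β : ℝ, |β| ≤ β₀ → ∀ ε : ℝ, 0 < ε → ∃ τ₀ : ℝ, 0 < τ₀ ∧ ∀ τ : ℝ, τ₀ ≤ τ →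
      ∃ N₀ : ℕ, ∀ N : ℕ, N₀ ≤ N → ∀ s ∈ Set.Icc 0 t₁,
        (let lo := fun (s : ℝ) (y : T3 × V3) =>
           (θ s y.1)⁻¹ * ∑ j : Fin 3, ∑ k : Fin 3,
               ((y.2 - u s y.1) j * (y.2 - u s y.1) k - (if j = k then ‖y.2 - u s y.1‖ ^ 2 / 3 else 0)) *
                 Torus.partialDeriv k (fun x => u s x j) y.1 +
             (∑ k : Fin 3, Torus.partialDeriv k (θ s) y.1 / (2 * (θ s y.1) ^ 2) * (y.2 - u s y.1) k) *
               G s (y.1, ‖y.2 - u s y.1‖ ^ 2)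
         ∫⁻ z, ENNReal.ofReal (Real.exp (β * ∑ i : Fin (N + 1),
             (τ * ((N : ℝ) + 1) ^ (-(1 / 3 : ℝ)))⁻¹ *
               ∫ r in (0 : ℝ)..(τ * ((N : ℝ) + 1) ^ (-(1 / 3 : ℝ))), lo s ((Φ N).flow r z i)))
           ∂(localGibbsLaw σ (a s) (u s) (θ s) N (Φ N)) ≤
         ENNReal.ofReal (Real.exp (ε * ((N : ℝ) + 1))))

/-- Sanity (v2): `KineticInstanceOut` IS the conclusion of the landed KC1. -/
example : Theorems.ClampedCurrentsDockKineticInstance.KineticInstance =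
    (Theorems.ClampedCurrentsDockKineticInstance.KineticCurrentsWindowLDFamily →
      Theorems.ClampedCurrentsDockKineticInstance.LoHeatFluxCutoffFamily → KineticInstanceOut) := rfl

/-- Sanity (v2): the heart's two family inputs copied in §1 ARE the decls of `Theorems.HydroLimitInBandOfHeart` (same terms). -/
example : LocalClampedTransferWindowLDFamily = Theorems.HydroLimitInBandOfHeart.LocalClampedTransferWindowLDFamily := rfl

example : CoherentSuprathermalContentVanishesW = Theorems.HydroLimitInBandOfHeart.CoherentSuprathermalContentVanishesW := rfl

/-- **THE PRODUCT KINETIC INSTANCE**: the line's local product node gives KC1's output. Proof plan: clamp the slab family to a global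
continuous positive family (`ClampedCurrentsDockKineticInstance.continuous_clamp`, `p s = max 0 (min t₁ s)`); choose the cut-off IN THE
THERMAL FRAME, `G s (x, s') := θ_s(x) · G̃(s'/θ_s(x))`, `G̃(r) = (r − 5)χ(r) + c̃ ψ(r)` with `χ = 1` on `[0, K⋆²/θ_min]`, `ψ` a bump beyond,
`c̃` the constant making `∫ ‖w‖² G̃(‖w‖²) dγ = 0` (so each `wₖ G̃(‖w‖²)` is `Orth`); then
`lo = Σ_{j,k} ∂ₖuⱼ · (w̃ⱼw̃ₖ − δⱼₖ‖w̃‖²/3) + Σₖ (∂ₖθ/(2√θ)) · w̃ₖ G̃(‖w̃‖²)`, `w̃ = (v − u)/√θ` — twelve thermal-frame PRODUCTS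
`φₘ(s,x) gₘ(w̃)` with `gₘ` x-independent, continuous, `Orth`, `|gₘ| ≤ c⋆(1 + ‖w̃‖²)` after normalisation and `φₘ` continuous,
`|12 β φₘ| ≤ 1` for `|β| ≤ β₀ := c⋆/(12 B)` (`B` a slab bound of the coefficients); generalized Hölder
`ENNReal.lintegral_prod_norm_pow_le` over the twelve window functionals (each split off on good orbits), each bounded by the node at
`ε`; thresholds `τ₀ := max`, `N₀ := max`. -/
def ProductKineticInstance : Prop :=
  LocalQuadraticWindowLDFamily → KineticInstanceOut

/-- **THE CLOCK FROM THE KINETIC INSTANCE** to `RelEntropyVanishing` verbatim. Proof plan: (1) a copy of the landed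
`HydroLimitInBandHeart.stub_windowClause` (399 lines) with its 8th antecedent `KineticCurrentsWindowLDFamily` replaced by `KineticInstanceOut`
(the original consumes KCWU only through `stub_kineticInstance hKC stub_loHeatFluxCutoffFamily`, line 170) ⟹ `WindowClauseInBand`; (2)
`HydroLimitInBandSplit.oneWindowLedgerStatic_of_clauses stub_staticClause`, `ClampedCurrentsDockFromWindows.stub_ledgerFromWindowsS`,
`ClampedCurrentsDockWindowContinuity.stub_windowContinuity` (CAT, CEAT from `TransferActivityTails` by
`HydroLimitInBandHeart.activityTails_of_transferActivityTails`; ECT by name), `EntropyClockDock.ledgerAprioriBound`,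
`HydroLimitInBandOfHeart.gronwallCoreInBand_of_ledger` ⟹ `GronwallCoreInBand` (guard `ρσ³ < η_c`); (3) UNGUARD: a copy of the landed
`EntropyClockDock.relEntropyDock_of_core` / `relEntropyDock_of_gronwallRf` (TwoClocksClampedWindowDock{TimeZero,Gronwall}) with the two idle
antecedents `KineticWindowLDUniform`, `ClampedTransferWindowLD` deleted (they are only threaded into `core`), the guard discharged inside
`core` by `DiluteSelfConsistency` at `η := η_c`, statics by `uniformLocalGibbsConcentration_proof`, `hsEosLowDensity_proof`. -/
def ClockFromInstance : Prop :=
  KineticInstanceOut → LocalClampedTransferWindowLDFamily → CoherentSuprathermalContentVanishesW →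
    TransferActivityTails → EnergyCurrentTails → DiluteSelfConsistency → RelEntropyVanishing

/-! ## §1c Statements added by the v7 reshape (lead c5): the profile-wise wall and the family glue -/

/-- **THE WALL NODE, PROFILE-WISE (v7): local quadratic-class window LD in product form, amplitude uniform over bounded
profile classes, thresholds pointwise, all windows.** There is a packing guard `η₀ > 0` such that for every temperature range
`0 < θm ≤ θM`, drift bound `U ≥ 0` and reduced density parameter `σ > 0` there is ONE amplitude `c⋆ > 0` such that for every
continuous local Gibbs datum `(a, θ₀, u₀)` on `𝕋³` with `a > 0`, `θm ≤ θ₀ ≤ θM`, `‖u₀‖ ≤ U` and `σ³·sup a ≤ η₀ ∫a`, every flow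
family, every continuous weight `|φ| ≤ 1` and every continuous thermal-frame profile `|g w| ≤ c⋆(1 + ‖w‖²)`, `g ⊥ span(1, w, ‖w‖²)`:
`∀ ε ∃ τ₀ ∀ τ ≥ τ₀ ∃ N₀ ∀ N ≥ N₀`, `∫ exp(Σᵢ w_N⁻¹∫₀^{w_N} φ(xᵢ(r)) g((vᵢ(r) − u₀(xᵢ(r)))/√θ₀(xᵢ(r))) dr) dλ^N ≤ e^{ε(N+1)}`,
`w_N = τ(N+1)^{-1/3}`, `λ^N = localGibbsLaw σ a u₀ θ₀ N (Φ N)`. This is the shape a cell/corridor transfer from global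
equilibrium DELIVERS (amplitude through bounds only: 14443 birth line, `FrozenEquilibriumCore`) and — by `FamilyGlue` below, PROVED
in v7 — all that the family node `LocalQuadraticWindowLDFamily` needs. Content = (i) locality + (ii) density band + (iii)b the
window clause under a non-invariant reference; conjecture-grade (open-problem), shared with TwoClocks 14443 / 16625-S3b. -/
def LocalQuadraticWindowLDBounds : Prop :=
  ∃ η₀ : ℝ, 0 < η₀ ∧ ∀ (θm θM U : ℝ), 0 < θm → θm ≤ θM → 0 ≤ U → ∀ σ : ℝ, 0 < σ →
    ∃ cstar : ℝ, 0 < cstar ∧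
    ∀ (a θ₀ : T3 → ℝ) (u₀ : T3 → V3), Continuous a → Continuous θ₀ → Continuous u₀ →
    (∀ x, 0 < a x) → (∀ x, θm ≤ θ₀ x) → (∀ x, θ₀ x ≤ θM) → (∀ x, ‖u₀ x‖ ≤ U) →
    σ ^ 3 * (⨆ x, a x) ≤ η₀ * ∫ x, a x →
    ∀ Φ : (N : ℕ) → TFlow σ N,
    ∀ (φ : T3 → ℝ) (g : V3 → ℝ), Continuous φ → Continuous g →
      (∀ x, |φ x| ≤ 1) → (∀ w, |g w| ≤ cstar * (1 + ‖w‖ ^ 2)) → Orth g →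
      ∀ ε : ℝ, 0 < ε → ∃ τ₀ : ℝ, 0 < τ₀ ∧ ∀ τ : ℝ, τ₀ ≤ τ → ∃ N₀ : ℕ, ∀ N : ℕ, N₀ ≤ N →
        ∫⁻ z, ENNReal.ofReal (Real.exp (∑ i : Fin (N + 1),
            (τ * ((N : ℝ) + 1) ^ (-(1 / 3 : ℝ)))⁻¹ *
              ∫ r in (0 : ℝ)..(τ * ((N : ℝ) + 1) ^ (-(1 / 3 : ℝ))),
                φ ((Φ N).flow r z i).1 *
                  g ((Real.sqrt (θ₀ ((Φ N).flow r z i).1))⁻¹ •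
                    (((Φ N).flow r z i).2 - u₀ ((Φ N).flow r z i).1))))
          ∂(localGibbsLaw σ a u₀ θ₀ N (Φ N)) ≤
        ENNReal.ofReal (Real.exp (ε * ((N : ℝ) + 1)))

/-- **THE WALL (v7, registered, OPEN)**: global quadratic class ⟹ the profile-wise bounds-uniform local product node. Same
exposure as v6's `LocalTransferQ` ((i) locality over one kinetic window under the hard-core local Gibbs law at the pressure level,
(ii) density-band uniformity, (iii)b the window clause under the non-invariant reference), now typed WITHOUT families: the
s-direction is the proved `FamilyGlue`. An implication between two open statements; not refutable short of its antecedent. -/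
def LocalTransferQB : Prop :=
  QuadraticClassLdDecay → LocalQuadraticWindowLDBounds

/-- **The dockable twin of the wall (v7)**: `EquilibriumFastWindowLD (14440) → LocalQuadraticWindowLDBounds` — weaker than
`LocalTransferQB` (`Quad ⇐ 14440` by the landed dock), the form a closed TwoClocks 14443 with bounds-uniform amplitude would give. -/
def LocalTransferEB : Prop :=
  Summit.AtomisticToContinuum.HydrodynamicLimit.Theses.TwoClocks.EquilibriumFastWindowLD → LocalQuadraticWindowLDBounds

/-- **THE FAMILY GLUE (v7, registered, provable — the lead's stub)**: the profile-wise bounds-uniform node gives the family node.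
Proof plan: fix the family `s ↦ (a_s, θ_s, u_s)` on `[0,t₁]` and read its bounds `θm, θM, U` off the compact slab; take
`c⋆ := c⋆_B(θm, θM, U, σ)/K` (`K` an absolute multiple of the frame constants); given `(φ, g, ε)`: choose the tail radius `R` by
`TailReorth` (projection coefficients `≤ η`), the bulk modulus by uniform continuity of `g` on `‖w‖ ≤ R'` and of `(s,x) ↦ (φ, θ, u)` on the slab,
the net spacing `δ` by `TwoProfileTransfer` at budget `ε/8`; at each of the finitely many net points `s'` apply the hypothesis to
`(φ(s',·), 8g)` and to `(1, 8c⋆K'·t^orth)`; `τ₀ := max`, `N₀ := max`; for `|s − s'| ≤ δ`: change of measure `λ_s → λ_{s'}` (order-2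
Rényi, cost `e^{ε(N+1)/8}`, square inside), then `2·(φ_s g_s) ≤ ¼[8 φ_{s'}g_{s'} + 8η'(1+‖v‖²)-energy + 8c⋆K' t^orth + 8c⋆K'(α + γ‖w̃‖²)-energy]`
pointwise, window monotonicity/linearity on good orbits, arithmetic-mean Jensen, and the four bounds (node; `WindowEnergyMoment`;
node; `WindowEnergyMoment`). -/
def FamilyGlue : Prop :=
  LocalQuadraticWindowLDBounds → LocalQuadraticWindowLDFamily

/-- **Helper stub `TwoProfileTransfer` (v7; static, no dynamics): order-2 Rényi change of measure between local Gibbs laws with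
nearby profiles.** For a temperature range `0 < θm ≤ θM` and a budget `δ > 0` there is a tolerance `ρ > 0` such that for any two
continuous data `(a₁, θ₁, u₁)`, `(a₂, θ₂, u₂)` within the range with `|log a₁ − log a₂| ≤ ρ`, `|θ₁ − θ₂| ≤ ρ`, `‖u₁ − u₂‖ ≤ ρ`
pointwise, every `0 < σ ≤ 1/2`, `N`, flow `Φ` and measurable `G ≥ 0`:
`∫ G dλ₁ ≤ e^{δ(N+1)} (∫ G² dλ₂)^{1/2}`. Proof plan: `∫ G dλ₁ = ∫ G (ψ₁/ψ₂) dλ₂ ≤ (∫G² dλ₂)^{1/2} (∫ ψ₁²ψ₂^{-1} dL)^{1/2}`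
(Hölder in `ℝ≥0∞` as in `KineticCurrentsWindowLDUniformSketch.stub_windowTransfer_of_renyi`, without the transport step), and the
order-2 Rényi integral is `≤ e^{2δ(N+1)}` by the two-profile form of `stub_staticFreezing`: per particle
`log f₁ − log f₂ ≤ e(5/2 + θm⁻¹) + e(1+θm⁻¹)/2·‖v − u₁(x)‖²` (`StaticFreezing.log_ratio_le`), `Z₂ ≤ e^{e(N+1)} Z₁`
(`StaticFreezing.canonicalPartition_le_pow_mul`), fibrewise Gaussian moment `(1 − 2sΘ)^{-3/2}`, tolerance `e(2, δ, θm, θM)`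
(`StaticFreezing.exists_tolerance`), `ρ(e)` from `|θ₁ − θ₂| ≤ ρ ⇒ |log θ₁ − log θ₂|, |θ₁⁻¹ − θ₂⁻¹| < e` on `[θm, θM]`. -/
def TwoProfileTransfer : Prop :=
  ∀ (θm θM : ℝ), 0 < θm → θm ≤ θM → ∀ δ : ℝ, 0 < δ → ∃ ρ : ℝ, 0 < ρ ∧
    ∀ (a₁ a₂ θ₁ θ₂ : T3 → ℝ) (u₁ u₂ : T3 → V3),
    Continuous a₁ → Continuous a₂ → Continuous θ₁ → Continuous θ₂ → Continuous u₁ → Continuous u₂ →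
    (∀ x, 0 < a₁ x) → (∀ x, 0 < a₂ x) →
    (∀ x, θm ≤ θ₁ x) → (∀ x, θ₁ x ≤ θM) → (∀ x, θm ≤ θ₂ x) → (∀ x, θ₂ x ≤ θM) →
    (∀ x, |Real.log (a₁ x) - Real.log (a₂ x)| ≤ ρ) → (∀ x, |θ₁ x - θ₂ x| ≤ ρ) → (∀ x, ‖u₁ x - u₂ x‖ ≤ ρ) →
    ∀ σ : ℝ, 0 < σ → σ ≤ 1 / 2 → ∀ (N : ℕ) (Φ : TFlow σ N) (G : Config (N + 1) (Fin 3) T3 → ℝ≥0∞), Measurable G →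
      ∫⁻ z, G z ∂(localGibbsLaw σ a₁ u₁ θ₁ N Φ) ≤
        ENNReal.ofReal (Real.exp (δ * ((N : ℝ) + 1))) *
          (∫⁻ z, G z ^ (2 : ℝ) ∂(localGibbsLaw σ a₂ u₂ θ₂ N Φ)) ^ (1 / 2 : ℝ)

/-- **Helper stub `WindowEnergyMoment` (v7; energy conservation + fibre Gaussians): the window exponential moment of the
quadratic one-body weight `λ(1 + ‖v‖²)` under a local Gibbs law.** For a temperature ceiling `θM > 0` and a drift bound `U ≥ 0`
there are `λ₀ > 0` and `C > 0` such that for every continuous datum `(a, θ₀, u₀)` with `a, θ₀ > 0`, `θ₀ ≤ θM`, `‖u₀‖ ≤ U`, every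
`0 < σ ≤ 1/2`, `N`, flow `Φ`, `0 ≤ λ ≤ λ₀` and window `w > 0`:
`∫ exp(Σᵢ w⁻¹∫₀ʷ λ(1 + ‖vᵢ(r)‖²) dr) dλ^N ≤ e^{Cλ(N+1)}`. Proof plan: on good orbits the window functional equals
`λ(N+1) + 2λ E(z)` (interval integrability of continuous one-body observables along good orbits, energy conservation
`IsHardSphereTrajectory.configEnergy_eq_holds`, cf. `KineticWindowGronwallQuadraticMoment.lintegral_exp_window_quadratic_eq`); the law is
carried by the good set (`ae_mem_good_localGibbsLaw`); statically `∫ Πᵢ e^{λ‖vᵢ‖²} dλ^N ≤ (sup_x ∫ e^{λ‖v‖²} N(u₀(x), θ₀(x)) dv)^{N+1}`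
(fibrewise factorisation over the velocity Maxwellians, `StaticFreezing` / `FibreExpMoment` pattern) and
`∫ e^{λ‖v‖²} dN(u, θ) = (1 − 2λθ)^{-3/2} e^{λ‖u‖²/(1−2λθ)} ≤ e^{(6θM + 2U²)λ}` for `λ ≤ 1/(4θM)`. -/
def WindowEnergyMoment : Prop :=
  ∀ (θM U : ℝ), 0 < θM → 0 ≤ U → ∃ lam₀ : ℝ, 0 < lam₀ ∧ ∃ C : ℝ, 0 < C ∧
    ∀ (a θ₀ : T3 → ℝ) (u₀ : T3 → V3), Continuous a → Continuous θ₀ → Continuous u₀ →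
    (∀ x, 0 < a x) → (∀ x, 0 < θ₀ x) → (∀ x, θ₀ x ≤ θM) → (∀ x, ‖u₀ x‖ ≤ U) →
    ∀ σ : ℝ, 0 < σ → σ ≤ 1 / 2 → ∀ (N : ℕ) (Φ : TFlow σ N) (lam : ℝ), 0 ≤ lam → lam ≤ lam₀ →
    ∀ w : ℝ, 0 < w →
      ∫⁻ z, ENNReal.ofReal (Real.exp (∑ i : Fin (N + 1),
          w⁻¹ * ∫ r in (0 : ℝ)..w, lam * (1 + ‖(Φ.flow r z i).2‖ ^ 2))) ∂(localGibbsLaw σ a u₀ θ₀ N Φ) ≤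
        ENNReal.ofReal (Real.exp (C * lam * ((N : ℝ) + 1)))

/-- **Helper stub `TailReorth` (v7; pure Gaussian analysis on `ℝ³`): the re-orthogonalised radial tail cut-off.** For every
`η > 0` and `R₀` there are a radius `R ≥ max(R₀, 1)`, a continuous radial cut-off `t` with `0 ≤ t ≤ 1 + ‖w‖²`, `t w = 1 + ‖w‖²` for
`‖w‖ ≥ R`, `t w = 0` for `‖w‖ ≤ R − 1`, and constants `|α|, |γ| ≤ η` such that `t − (α + γ‖w‖²)` is orthogonal to
`span(1, w, ‖w‖²)` under the standard Gaussian. Proof plan: `t(w) := (1 + ‖w‖²)·min(1, max(0, ‖w‖ − (R − 1)))`; the linear part of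
the orthogonality is free by oddness (`w ↦ −w` preserves the Gaussian, `t` is even); `(α, γ)` solve the `2 × 2` Gram system of
`(1, ‖w‖²)` (nonsingular by Cauchy–Schwarz, as in `KineticWindowGronwallReorthCutPrelim`) against `(∫ t dγ, ∫ t‖w‖² dγ)`, and both
right-hand sides tend to `0` as `R → ∞` by dominated convergence (dominator `(1 + ‖w‖²)‖w‖²`), so `|α|, |γ| ≤ η` for `R` large. -/
def TailReorth : Prop :=
  ∀ η : ℝ, 0 < η → ∀ R₀ : ℝ, ∃ R : ℝ, R₀ ≤ R ∧ 1 ≤ R ∧ ∃ (t : V3 → ℝ) (α γ : ℝ),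
    Continuous t ∧ |α| ≤ η ∧ |γ| ≤ η ∧
    (∀ w, 0 ≤ t w) ∧ (∀ w, t w ≤ 1 + ‖w‖ ^ 2) ∧ (∀ w, R ≤ ‖w‖ → t w = 1 + ‖w‖ ^ 2) ∧
    (∀ w, ‖w‖ ≤ R - 1 → t w = 0) ∧
    Orth (fun w => t w - (α + γ * ‖w‖ ^ 2))

/-! ## §2 Registered stubs (v7: seven sorries) -/

/-- STUB 0 (v6; INPUT BY NAME, board crux TwoClocks stmt-AtomisticToContinuum-14440 `EquilibriumFastWindowLD`: window LD at global equilibrium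
for every continuous fast one-body `F(x,v)` of quadratic growth — the fixed-density kinetic wall in its friendliest form; staffed on its own item). -/
theorem stub_equilibriumFastWindowLD : Summit.AtomisticToContinuum.HydrodynamicLimit.Theses.TwoClocks.EquilibriumFastWindowLD := by
  sorry

/-- STUB 1 — PROVED in v6 (lead c4): the rare band follows from STUB 0 through the landed dock
`KineticWindowGronwallRareBandDock.rareBandLdDecay_of_equilibriumFastWindowLD` (14440 ⟹ quadratic class ⟹ rare band). Docstring of v1–v5 kept for
the record: rare-band LD decay at global equilibrium, fixed small `σ`. First kit action
for the lead (card falsifier (c), TRIAGE-r1-1): equilibrium MD band-variance ratios `r_k(τ)` of the re-orthogonalised band pieces of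
the heat current at `2^k = 3, 4, 6 v̄` — prediction `r_k ∝ 1/(2^k τ)`, faster decay for higher bands, no plateau. -/
theorem stub_rareBand : RareBandLdDecay :=
  Summit.AtomisticToContinuum.HydrodynamicLimit.Theorems.KineticWindowGronwallRareBandDock.rareBandLdDecay_of_equilibriumFastWindowLD
    stub_equilibriumFastWindowLD

/-- STUB 2a — LANDED (wave-1 worker, `Theorems/AntiMazurCoboundariesKineticWindowGronwallReorthCut.lean` p140004, prelim
`…ReorthCutPrelim.lean` p139550): the static re-orthogonalising cut (cut-off in `s = ‖w‖²`, block-diagonal Gram re-orthogonaliser on two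
disjoint radial tents, Cramer bounds). Same term. -/
theorem stub_reorthCut : ReorthogonalisingCut :=
  Summit.AtomisticToContinuum.HydrodynamicLimit.Theorems.KineticWindowGronwallReorthCut.stub_reorthCut

/-- STUB 2b — LANDED (lead c3, `Theorems/AntiMazurCoboundariesKineticWindowGronwallLadderAssembly.lean`, helper
`…LadderWindowUpgrade.lean` p139021): the ladder assembly — A USED HERE at its own amplitude `κ` (window upgrade by subadditivity +
two-window Hölder + Jensen-in-time static bounds, common window, Cauchy–Schwarz). Same term as the Theorems statement. -/
theorem stub_ladderAssembly : LadderAssembly :=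
  Summit.AtomisticToContinuum.HydrodynamicLimit.Theorems.KineticWindowGronwallLadder.stub_ladderAssembly

/-- STUB 3-QB (v7; crux-sized, OPEN, SHARED wall: TwoClocks 14443 / 16625-S3b in product form, now PROFILE-WISE): global quadratic
class ⟹ the bounds-uniform local product node (locality over one window + density band + window clause under the local reference). -/
theorem stub_localTransferQB : LocalTransferQB := by
  sorry

/-- STUB 3-T — LANDED (wave-1 worker, `Theorems/AntiMazurCoboundariesKineticWindowGronwallTwoProfileTransfer.lean` p148641): static
order-2 Rényi change of measure between local Gibbs laws with nearby profiles (reusing the landed `LawChange` two-profile statics). Same term. -/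
theorem stub_twoProfileTransfer : TwoProfileTransfer :=
  Summit.AtomisticToContinuum.HydrodynamicLimit.Theorems.KineticWindowGronwallTwoProfileTransfer.stub_twoProfileTransfer

/-- STUB 3-E — LANDED (wave-1 worker, `Theorems/AntiMazurCoboundariesKineticWindowGronwallWindowEnergyMoment.lean` p146839): window
exponential moment of `λΣᵢ(1 + ‖vᵢ‖²)` by energy conservation + fibre Gaussians (`lam₀ = 1/(8θM)`, `C = 1 + 2U² + 12θM`). Same term. -/
theorem stub_windowEnergyMoment : WindowEnergyMoment :=
  Summit.AtomisticToContinuum.HydrodynamicLimit.Theorems.KineticWindowGronwallWindowEnergyMoment.stub_windowEnergyMoment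

/-- STUB 3-R — LANDED (wave-1 worker, `Theorems/AntiMazurCoboundariesKineticWindowGronwallTailReorth.lean` p147043): the
re-orthogonalised radial tail cut-off (`t = (1+‖w‖²)·ramp`, Cramer on the `(1, ‖w‖²)` Gram system, tail moments `≤ C/(R−1)²`). Same term. -/
theorem stub_tailReorth : TailReorth :=
  Summit.AtomisticToContinuum.HydrodynamicLimit.Theorems.KineticWindowGronwallTailReorth.stub_tailReorth

/-- STUB 3-G — PROVED (lead c5, `Theorems/AntiMazurCoboundariesKineticWindowGronwallFamilyGlue.lean` p148139, with
`…FamilyGlueCompare` p147635 and `…FamilyGluePrelim` p148049): the family glue `familyGlue_of : TwoProfileTransfer → WindowEnergyMoment →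
TailReorth → FamilyGlue` (s-net + static two-profile Rényi change of measure + energy conservation + the node on one re-orthogonalised
tail observable per net point), fed here by the three LANDED helper stubs. -/
theorem stub_familyGlue : FamilyGlue :=
  Summit.AtomisticToContinuum.HydrodynamicLimit.Theorems.KineticWindowGronwallFamilyGlue.familyGlue_of
    stub_twoProfileTransfer stub_windowEnergyMoment stub_tailReorth

/-- STUB 3 — DERIVED in v7: `LocalTransferQ` from the wall `stub_localTransferQB` and the glue `stub_familyGlue`. -/
theorem stub_localTransfer : LocalTransferQ :=
  fun hQ => stub_familyGlue (stub_localTransferQB hQ)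

/-- STUB 4a — LANDED (wave-1 worker, `Theorems/AntiMazurCoboundariesKineticWindowGronwallProductKineticInstance.lean` p140192, prelims
`…ProductKineticInstanceCutoff.lean` p139986, `…ProductKineticInstanceSplit.lean` p139766): the product node gives the landed kinetic instance's
output (x-independent re-orthogonalised thermal cut-off `G := θ·G̃(·/θ)`, twelve thermal-frame products, Jensen over the rank). Same term. -/
theorem stub_productKineticInstance : ProductKineticInstance :=
  Summit.AtomisticToContinuum.HydrodynamicLimit.Theorems.KineticWindowGronwallProductKineticInstance.stub_productKineticInstance

/-- STUB 4b — LANDED (wave-1 worker, `Theorems/AntiMazurCoboundariesKineticWindowGronwallClockFromInstance.lean` p139122): the window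
clause re-run on KC1's output (`windowClauseInBand_of_instance`), the ledger, the guarded Grönwall core (`gronwallCoreInBand_of_instance`),
unguarded by dilute self-consistency (`relEntropyVanishing_of_gronwallCoreInBand`), to `RelEntropyVanishing` verbatim. Same term. -/
theorem stub_clockFromInstance : ClockFromInstance :=
  Summit.AtomisticToContinuum.HydrodynamicLimit.Theorems.KineticWindowGronwallClockFromInstance.stub_clockFromInstance

/-- STUB 5 (inputs by name, staffed on their own items): local C′ along families, weighted coherence, 16624, 9235, 3091. -/
theorem stub_sharedInputs : SharedInputs := by
  sorry

/-! ## §3 The composition (kernel-checked, no sorry of its own): the seven stubs imply the crux BY NAME, and A is consumed -/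

/-- v1's `stub_amplitudeLadder` from the two v2 pieces. -/
theorem amplitudeLadder_of (h₁ : ReorthogonalisingCut) (h₂ : LadderAssembly) : AmplitudeLadder :=
  h₂ h₁

/-- v1's `stub_entropyClockRE` from the two v2 pieces. -/
theorem entropyClockRE_of (h₁ : ProductKineticInstance) (h₂ : ClockFromInstance) : EntropyClockRE :=
  fun hQ => h₂ (h₁ hQ)

/-- `stub₁ → … → stub₇ → KineticWindowGronwall`: the antecedent `A` enters the ladder (bulk at amplitude `κ`), the rare band supplies
the far tail, the transfer localises the quadratic class along the Euler family, the product node feeds the landed kinetic instance, and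
the landed heart (with the shared inputs and dilute self-consistency) reaches `RelEntropyVanishing`. -/
theorem KineticWindowGronwall_of :
    RareBandLdDecay → ReorthogonalisingCut → LadderAssembly → LocalTransferQ → ProductKineticInstance → ClockFromInstance →
      SharedInputs → Summit.AtomisticToContinuum.HydrodynamicLimit.Theses.AntiMazurCoboundaries.KineticWindowGronwall :=
  fun h₁ h₂ h₃ h₄ h₅ h₆ h₇ hA => h₆ (h₅ (h₄ (h₃ h₂ hA h₁))) h₇.1 h₇.2.1 h₇.2.2.1 h₇.2.2.2.1 h₇.2.2.2.2

/-- The crux from the registered stubs (every `sorry` sits inside a `stub_*`). -/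
theorem KineticWindowGronwall_skeleton :
    Summit.AtomisticToContinuum.HydrodynamicLimit.Theses.AntiMazurCoboundaries.KineticWindowGronwall :=
  KineticWindowGronwall_of stub_rareBand stub_reorthCut stub_ladderAssembly stub_localTransfer stub_productKineticInstance
    stub_clockFromInstance stub_sharedInputs

/-- The shared sibling decl (route FluxGibbsianityLdDrude, same item 9282) is the same term, so the skeleton serves both. -/
example : Summit.AtomisticToContinuum.HydrodynamicLimit.Theses.AntiMazurCoboundaries.KineticWindowGronwall =
    Summit.AtomisticToContinuum.HydrodynamicLimit.Theses.FluxGibbsianityLdDrude.KineticWindowGronwall := rfl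

/-- The skeleton's entry point for the item's primary decl (route FluxGibbsianityLdDrude; same term). -/
theorem KineticWindowGronwall_proof :
    Summit.AtomisticToContinuum.HydrodynamicLimit.Theses.FluxGibbsianityLdDrude.KineticWindowGronwall :=
  KineticWindowGronwall_skeleton

/-- … and by name for the AntiMazurCoboundaries decl, directly from the composition. -/
theorem KineticWindowGronwall_proof' :
    Summit.AtomisticToContinuum.HydrodynamicLimit.Theses.AntiMazurCoboundaries.KineticWindowGronwall :=
  KineticWindowGronwall_of stub_rareBand stub_reorthCut stub_ladderAssembly stub_localTransfer stub_productKineticInstance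
    stub_clockFromInstance stub_sharedInputs

/-- v6: **the crux from the BOARD** — `EquilibriumFastWindowLD (14440) → LocalTransferQ → SharedInputs → KineticWindowGronwall`
(the landed dock feeds the rare band; cut, ladder, product instance and clock are landed). -/
theorem KineticWindowGronwall_of_board
    (h₀ : Summit.AtomisticToContinuum.HydrodynamicLimit.Theses.TwoClocks.EquilibriumFastWindowLD) (h₄ : LocalTransferQ) (h₇ : SharedInputs) :
    Summit.AtomisticToContinuum.HydrodynamicLimit.Theses.AntiMazurCoboundaries.KineticWindowGronwall :=
  KineticWindowGronwall_of
    (Summit.AtomisticToContinuum.HydrodynamicLimit.Theorems.KineticWindowGronwallRareBandDock.rareBandLdDecay_of_equilibriumFastWindowLD h₀)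
    stub_reorthCut stub_ladderAssembly h₄ stub_productKineticInstance stub_clockFromInstance h₇

/-- v6: the registered transfer implies the board transfer (the dock supplies the quadratic class from 14440). -/
theorem localTransferE_of_localTransferQ (h₄ : LocalTransferQ) : LocalTransferE :=
  fun h₀ => h₄ (Summit.AtomisticToContinuum.HydrodynamicLimit.Theorems.KineticWindowGronwallRareBandDock.quadraticClassLdDecay_of_equilibriumFastWindowLD h₀)

/-- v6: **the crux from the board through the WEAKER transfer** — `EquilibriumFastWindowLD → LocalTransferE → SharedInputs → crux`
(product instance and clock landed; the ladder is bypassed, A idle given 14440 — see `antecedent_of_equilibriumFastWindowLD`). -/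
theorem KineticWindowGronwall_of_board'
    (h₀ : Summit.AtomisticToContinuum.HydrodynamicLimit.Theses.TwoClocks.EquilibriumFastWindowLD) (h₄ : LocalTransferE) (h₇ : SharedInputs) :
    Summit.AtomisticToContinuum.HydrodynamicLimit.Theses.AntiMazurCoboundaries.KineticWindowGronwall :=
  fun _ => stub_clockFromInstance (stub_productKineticInstance (h₄ h₀)) h₇.1 h₇.2.1 h₇.2.2.1 h₇.2.2.2.1 h₇.2.2.2.2

/-- v7: the registered transfer QB implies the board form EB (the dock supplies the quadratic class from 14440). -/
theorem localTransferEB_of_localTransferQB (h : LocalTransferQB) : LocalTransferEB :=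
  fun h₀ => h (Summit.AtomisticToContinuum.HydrodynamicLimit.Theorems.KineticWindowGronwallRareBandDock.quadraticClassLdDecay_of_equilibriumFastWindowLD h₀)

/-- v7: the v6 dockable transfer `LocalTransferE` from the profile-wise one and the glue. -/
theorem localTransferE_of_localTransferEB (h : LocalTransferEB) (hG : FamilyGlue) : LocalTransferE :=
  fun h₀ => hG (h h₀)

/-- v7: **the crux from the nine v7 pieces** — rare band, cut, ladder, PROFILE-WISE WALL, GLUE, product instance, clock, shared
inputs; A consumed by the ladder (same term as `KineticWindowGronwall_of` with `h₄ := glue ∘ wall`). -/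
theorem KineticWindowGronwall_of_v7 :
    RareBandLdDecay → ReorthogonalisingCut → LadderAssembly → LocalTransferQB → FamilyGlue → ProductKineticInstance →
      ClockFromInstance → SharedInputs →
      Summit.AtomisticToContinuum.HydrodynamicLimit.Theses.AntiMazurCoboundaries.KineticWindowGronwall :=
  fun h₁ h₂ h₃ h₄ hG h₅ h₆ h₇ => KineticWindowGronwall_of h₁ h₂ h₃ (fun hQ => hG (h₄ hQ)) h₅ h₆ h₇

/-- v7: **the crux from the BOARD through the profile-wise wall** — `EquilibriumFastWindowLD (14440) → LocalTransferEB → FamilyGlue →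
SharedInputs → crux` (A idle given 14440, as in v6). -/
theorem KineticWindowGronwall_of_board_v7
    (h₀ : Summit.AtomisticToContinuum.HydrodynamicLimit.Theses.TwoClocks.EquilibriumFastWindowLD) (h₄ : LocalTransferEB)
    (hG : FamilyGlue) (h₇ : SharedInputs) :
    Summit.AtomisticToContinuum.HydrodynamicLimit.Theses.AntiMazurCoboundaries.KineticWindowGronwall :=
  KineticWindowGronwall_of_board' h₀ (localTransferE_of_localTransferEB h₄ hG) h₇

/-- v7.1: **the wall in TwoClocks' vocabulary suffices** — `EquilibriumFastWindowLD (14440) → LocalGibbsTransferPlus → SharedInputs → crux`,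
where `LocalGibbsTransferPlus := EquilibriumFastWindowLD → KineticWindowLDBoundsUniform` (landed `Theorems.KineticWindowGronwallPlusNode`:
14442's general-`F` class, bounds-uniform tilt radius, window clause; it implies TwoClocks' crux 14443 AND `LocalTransferEB`). Uses the glue
(all its helpers landed). -/
theorem KineticWindowGronwall_of_plus
    (h₀ : Summit.AtomisticToContinuum.HydrodynamicLimit.Theses.TwoClocks.EquilibriumFastWindowLD)
    (hP : Summit.AtomisticToContinuum.HydrodynamicLimit.Theorems.KineticWindowGronwallPlusNode.LocalGibbsTransferPlus)
    (h₇ : SharedInputs) :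
    Summit.AtomisticToContinuum.HydrodynamicLimit.Theses.AntiMazurCoboundaries.KineticWindowGronwall :=
  KineticWindowGronwall_of_board_v7 h₀
    (Summit.AtomisticToContinuum.HydrodynamicLimit.Theorems.KineticWindowGronwallPlusNode.localTransferEB_of_plus hP)
    stub_familyGlue h₇

/-- v7.1 honesty: the wall in TwoClocks' vocabulary is a STRENGTHENING of the board crux `TwoClocks.LocalGibbsTransfer` (stmt-14443). -/
theorem localGibbsTransfer_of_plus
    (hP : Summit.AtomisticToContinuum.HydrodynamicLimit.Theorems.KineticWindowGronwallPlusNode.LocalGibbsTransferPlus) :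
    Summit.AtomisticToContinuum.HydrodynamicLimit.Theses.TwoClocks.LocalGibbsTransfer :=
  Summit.AtomisticToContinuum.HydrodynamicLimit.Theorems.KineticWindowGronwallPlusNode.localGibbsTransfer_of_plus hP

/-! ## §4 Honesty lemmas (sorry-free) -/

/-- v6 HONESTY: **given STUB 0 the crux's antecedent is formally idle** — `EquilibriumFastWindowLD → KineticFluxLdDecay` (landed
`kineticFluxLdDecay_of_equilibriumFastWindowLD`: TwoClocks' crux 14440 implies AntiMazur/FluxGibbsianity's crux 10967 by Baire uniformity + flow
independence + frame change). A stays load-bearing only relative to the strictly weaker pair `(A, RareBandLdDecay)`: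
`QuadraticClassLdDecay ↔ A ∧ RareBandLdDecay` (`quadraticClass_iff_of_cut`) and `QuadraticClassLdDecay ⇐ 14440` (the dock); the converse of the dock
(product class ⇒ general `F(x,v)`) is not formal. -/
theorem antecedent_of_equilibriumFastWindowLD
    (h₀ : Summit.AtomisticToContinuum.HydrodynamicLimit.Theses.TwoClocks.EquilibriumFastWindowLD) : KineticFluxLdDecay :=
  Summit.AtomisticToContinuum.HydrodynamicLimit.Theorems.KineticWindowGronwallRareBandDock.kineticFluxLdDecay_of_equilibriumFastWindowLD h₀


/-- A IS LOAD-BEARING IN THIS COMPOSITION: with the cut, the assembly, the transfer, the two clock pieces and the shared inputs granted,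
the crux's antecedent and the rare band TOGETHER give the consequent — the form in which the six non-antecedent stubs are consumed. (The
rare band alone does not: its class has no member that is nonzero near `w = 0`, so it cannot replace `A` in `h₃`.) -/
theorem relEntropyVanishing_of_antecedent_and_rareBand (h₂ : ReorthogonalisingCut) (h₃ : LadderAssembly) (h₄ : LocalTransferQ)
    (h₅ : ProductKineticInstance) (h₆ : ClockFromInstance) (h₇ : SharedInputs) (hA : KineticFluxLdDecay) (h₁ : RareBandLdDecay) :
    RelEntropyVanishing :=
  h₆ (h₅ (h₄ (h₃ h₂ hA h₁))) h₇.1 h₇.2.1 h₇.2.2.1 h₇.2.2.2.1 h₇.2.2.2.2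

/-- The bounded class sits inside the quadratic class at the same constant — so `QuadraticClassLdDecay → KineticFluxLdDecay`
(the ladder's output is a genuine strengthening of the crux's antecedent; pure logic + `κ ≤ κ(1 + ‖v‖²)`). -/
theorem kineticFluxLdDecay_of_quadraticClass (hQ : QuadraticClassLdDecay) : KineticFluxLdDecay := by
  intro a θ u₀ ha hθ
  obtain ⟨σ₀, hσ₀, H⟩ := hQ a θ u₀ ha hθ
  refine ⟨σ₀, hσ₀, fun σ hσ hσlt => ⟨(H σ hσ hσlt).1, ?_⟩⟩
  obtain ⟨cstar, hc, Hc⟩ := (H σ hσ hσlt).2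
  refine ⟨cstar, hc, fun φ g hφ hg hφ1 hgκ horth δ hδ => ?_⟩
  have hgq : ∀ v, |g v| ≤ cstar * (1 + ‖v‖ ^ 2) := fun v => by
    refine (hgκ v).trans ?_
    have h1 : (1 : ℝ) ≤ 1 + ‖v‖ ^ 2 := le_add_of_nonneg_right (sq_nonneg _)
    simpa using mul_le_mul_of_nonneg_left h1 hc.le
  exact Hc φ g hφ hg hφ1 hgq horth δ hδ

/-- **The rare band is EXACTLY the missing half of the quadratic class**: `QuadraticClassLdDecay → RareBandLdDecay` (the band class at
amplitude `c⋆` sits inside the quadratic class at the same constant; `V₁ := 1`). With `kineticFluxLdDecay_of_quadraticClass` and the ladder,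
`QuadraticClassLdDecay ↔ KineticFluxLdDecay ∧ RareBandLdDecay` given the cut (`quadraticClass_iff_of_cut`): the ladder is lossless and the W1
debt of the record is the rare band, no more and no less. -/
theorem rareBand_of_quadraticClass (hQ : QuadraticClassLdDecay) : RareBandLdDecay := by
  intro a θ u₀ ha hθ
  obtain ⟨σ₀, hσ₀, H⟩ := hQ a θ u₀ ha hθ
  refine ⟨σ₀, hσ₀, fun σ hσ hσlt => ⟨(H σ hσ hσlt).1, ?_⟩⟩
  obtain ⟨cstar, hc, Hc⟩ := (H σ hσ hσlt).2
  refine ⟨cstar, hc, 1, one_pos, fun φ g hφ hg hφ1 hgc _ horth δ hδ => ?_⟩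
  have hgq : ∀ v, |g v| ≤ cstar * (1 + ‖v‖ ^ 2) := fun v => by
    refine (hgc v).trans ?_
    have h1 : ‖v‖ ^ 2 ≤ 1 + ‖v‖ ^ 2 := le_add_of_nonneg_left zero_le_one
    exact mul_le_mul_of_nonneg_left h1 hc.le
  exact Hc φ g hφ hg hφ1 hgq horth δ hδ

/-- `QuadraticClassLdDecay ↔ KineticFluxLdDecay ∧ RareBandLdDecay`, given the re-orthogonalising cut and the ladder assembly. -/
theorem quadraticClass_iff_of_cut (h₂ : ReorthogonalisingCut) (h₃ : LadderAssembly) :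
    QuadraticClassLdDecay ↔ (KineticFluxLdDecay ∧ RareBandLdDecay) :=
  ⟨fun hQ => ⟨kineticFluxLdDecay_of_quadraticClass hQ, rareBand_of_quadraticClass hQ⟩, fun h => h₃ h₂ h.1 h.2⟩

/-- Disproof §4 / `Negative/CubicMomentDiverges`: cubic exponential moments of a Maxwellian are infinite — the reason every LD
statement of this line is quadratic-class (`c⋆ < 1/2`) and the suprathermal heat flux is paid in mean inside the heart. -/
theorem honours_cubic {α : ℝ} (hα : 0 < α) :
    ∫⁻ x, ENNReal.ofReal (Real.exp (α * x ^ 3)) ∂(ProbabilityTheory.gaussianReal 0 1) = ∞ :=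
  Summit.AtomisticToContinuum.HydrodynamicLimit.Theorems.KineticWindowGronwallNegative.lintegral_exp_mul_pow_three_eq_top hα

/-- Disproof §2 / `Negative/ConsequentLoadBearing`: given the antecedent, the UNTIED consequent is false — the clock keeps the
`t = 0` tie and the Euler balance laws (inside the heart) and concludes `RelEntropyVanishing` verbatim. -/
theorem honours_tie (hA : KineticFluxLdDecay) :
    ¬ (KineticFluxLdDecay →
      Summit.AtomisticToContinuum.HydrodynamicLimit.Theorems.KineticWindowGronwallNegative.RelEntropyVanishingUntied) :=
  Summit.AtomisticToContinuum.HydrodynamicLimit.Theorems.KineticWindowGronwallNegative.crux_untied_false_of_antecedent hA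

end Summit.AtomisticToContinuum.HydrodynamicLimit.Cruxes.KineticWindowGronwall.RareBandLadderDock

end
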